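import Literature.Probability.RandomPlanarGeometry.YangBaxterSAWHexDictionary
import Literature.Barriers.CriticalPhenomena.PlaquetteWalkAngleZeroCount
import HarnessLib

/-!
# The `θ = 2π/3` dictionary of Glazman–Manolescu (the second hexagonal angle) and the parafermionic
observable at every root orientation: the dihedral group acts on the observable itself

Topic `Literature/Probability/RandomPlanarGeometry`; companion of `YangBaxterSAWHexDictionary.lean` (the `θ = π/3`
dictionary: `Face.hv`, `triSet`, `hexObservableAt`, `parafermionOn_pi_div_three_eq_hexObservableAt(_of_W_root)`,
`vertexFunctional_printed_pi_div_three_eq_sum_cv_of_W_root`, `…_eq_sum_encircling`, §16 root orientations) and of the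
lane's `PlaquetteWalkMirrorDuality.lean` (the reflections `mirrorRow c`, `mirrorCol c`, `mirrorDiag` of the lattice of
rhombi, the covariance of the CATALOGUE observable `gmObservable` and of the vertex functional `VF`).

What the sources print. A. Glazman, I. Manolescu, arXiv:1708.00395v3, §1 (p. 3, with Fig. 2): «if Θ is the constant
sequence equal to π/3, then each rhombus of H(Θ) may be partitioned into triangles, and H(Θ) becomes a triangular
lattice. The self-avoiding walk model described above becomes that on the hexagonal lattice»; §1, after eq. (1): the
weights at `θ` and `π − θ` are exchanged by the corner swap `u₁ ↔ u₂`, `w₁ ↔ w₂` (the tree's `printedWeights_swap`), so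
that the rhombus of angle `2π/3` is the rhombus of angle `π/3` seen from its other pair of corners — BOTH endpoints
`π/3` and `2π/3` of the printed range `[π/3, 2π/3]` are hexagonal points. H. Duminil-Copin, S. Smirnov, Ann. of Math.
175 (2012), Definition 1 (`F(z) = Σ e^{−iσW} x^ℓ`), Lemma 1 (the vertex relation) and the proof of Lemma 2 («The
symmetry of our domain implies that F(z̄) = F̄(z)»).

What is formalised here (namespace `…SAW.YangBaxter`; everything for an ARBITRARY finite face list `Dl`, holes allowed).

* §1 THE DIHEDRAL GROUP ACTS ON THE PARAFERMIONIC OBSERVABLE `parafermionOn` (GM19's `F` of eq. (2.1), rhombic winding)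
  — not only on the catalogue's square-frame `gmObservable` (MirrorDuality §4/§7/§9): the slant potentials of the
  winding transfer cancel exactly (`slantPot_mirrorRow/_mirrorCol`, `slantPot_pi_sub`, `slantPot_add_slantPot_mirrorDiag`:
  `κ_θ(z) + κ_θ(τz) = θ − π/2`), giving ★ `parafermionOn_dom_map_mirrorRow_eq_conj` / `…_mirrorCol_eq_conj`
  (`F^{ρD}_θ(ρa → ρz) = conj F^{D}_{π−θ}(a → z)`: reflections in lattice axes are ANTI-linear and exchange
  `θ ↔ π − θ`), ★ `parafermionOn_dom_map_mirrorDiag_eq_conj` (`F^{τD}_θ(τa → τz) = conj F^{D}_θ(a → z)`: the diagonal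
  reflection is anti-linear at FIXED `θ`), `parafermionOn_dom_halfTurn` (the half turn is LINEAR and fixes `θ`),
  `parafermionOn_dom_antiDiag_eq_conj`.
* §2 ★★ THE `θ = 2π/3` DICTIONARY, WALK AND OBSERVABLE LEVEL: `pi_sub_pi_div_three`,
  `printedWeights_two_pi_div_three` (`= (printedWeights (π/3)).swap`), ★ `YBWalk.weight_two_pi_div_three_ne_zero_iff_nodup`
  (the weight at `2π/3` is non-zero iff the triangle list of the ROW-REFLECTED walk is self-avoiding), ★ THE WINDING DUALITY
  `arcTurn_mirrorSide_eq_neg_pi_sub` / `YBWalk.winding_mirrorWalk_eq_neg_pi_sub` (`wind_θ(ργ) = −wind_{π−θ}(γ)` for every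
  walk — MirrorDuality's quarter-turn lemma is the case `θ = π/2`), ★★ `YBWalk.winding_two_pi_div_three_eq_neg_pturn`
  (THE WINDING OF A YANG–BAXTER WALK AT `2π/3` IS `−(π/3)·` THE HONEYCOMB TURNING NUMBER OF ITS REFLECTED TRIANGLE WALK),
  ★★ `YBWalk.paraWeight_two_pi_div_three` (its parafermionic weight is the CONJUGATE of Duminil-Copin–Smirnov's
  `x_c^ℓ λ^{pturn}` of that walk), ★★
  `parafermionOn_two_pi_div_three_eq_conj_hexObservableAt` (root at the origin) and
  `…_of_W_root` (root on the `W` side of any rhombus `w`, reflection in the row of `w`, which fixes the root):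
  `F_{Dl}(w.side W; z)` at `Θ ≡ 2π/3` is the COMPLEX CONJUGATE of Duminil-Copin–Smirnov's observable of the triangle
  domain of the REFLECTED list `ρ_w Dl` at the reflected side — i.e. of the honeycomb lattice obtained by splitting every
  rhombus along its OTHER diagonal (triangles `{W, S}` / `{N, E}` instead of `{W, N}` / `{S, E}`), as GM19's sentence
  requires at the angle `2π/3` (the equilateral split of a rhombus of angle `2π/3` at `W ∩ N` runs through `W ∩ N`).
* §3 ★★ THE VERTEX FUNCTIONAL AND THE HOLE-ROOT DEFECT AT `θ = 2π/3`:
  `vertexFunctional_printed_two_pi_div_three_eq_neg_conj_sum_cv_of_W_root`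
  (`(2ω − 1)·VF_{2π/3}(Dl; w.side W; f) = −conj Σ (c_{T₁'} + c_{T₂'})` over DCS's mid-edge walks of the reflected
  triangle domain, `T₁', T₂'` the two triangles of `ρ_w f`), `vertexFunctional_printed_two_pi_div_three_eq_conj_sum_crCoef`
  (the (CR) contour form at the origin), ★★ `vertexFunctional_printed_two_pi_div_three_eq_neg_conj_sum_encircling`
  (THE DEFECT AT `2π/3` IS MINUS THE CONJUGATE OF THE SIGNED WEIGHT OF THE ENCIRCLING HONEYCOMB LOOP-CLASS WALKS OF THE
  REFLECTED TRIANGLE DOMAIN, ∘ dictionary §15) and `…_eq_zero_of_loopWnd` (no reflected loop through `T₁', T₂'` winds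
  about the root face ⇒ the Yang–Baxter relation holds at `f` at `2π/3` — the lane's «2π/3-only» endpoint zeros);
  `boundarySum_printed_map_mirrorRow_duality` (the boundary flux of the lane's discrete Stokes identity is mirror-dual on
  every domain) and ★★ `boundarySum_printed_two_pi_div_three_eq_neg_conj_sum_encircling` (TOTAL ENCIRCLING WEIGHT OF THE
  OTHER TRIANGULATION = `−conj((2ω − 1)·` boundary flux at `2π/3)`, ∘ dictionary §17).
* §4 THE OBSERVABLE AT `E`-, `S`-, `N`-ROOTS AT `π/3` (observable-level companions of the dictionary's §16, by §1):
  `parafermionOn_pi_div_three_eq_hexObservableAt_of_E_root` (half turn, linear), `…_eq_conj_hexObservableAt_of_S_root`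
  (diagonal, anti-linear), `…_eq_conj_hexObservableAt_of_N_root` (anti-diagonal, anti-linear).
* §5 BOTH HEXAGONAL ANGLES AS EXACT TESTS FOR «VF ≢ 0» (∘ `PlaquetteWalkAngleZeroCount`):
  `vertexFunctional_printed_zero_set_of_endpoint_ne_zero` (VF ≠ 0 at `π/3` or at `2π/3` ⇒ at most `4K + 1` zero angles
  in `(0, π)`), ★ `vertexFunctional_printed_zero_set_of_sum_encircling_ne_zero` / `…_reflected_ne_zero` (a non-zero
  encircling sum of `Dl` at `f`, or of `ρ_w Dl` at `ρ_w f`, certifies «VF ≢ 0» with the explicit count), and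
  `sum_encircling_eq_zero_and_reflected_of_forall_eq_zero` (VF ≡ 0 on `(0, π)` forces BOTH honeycomb sums to vanish).

* §6 `vertexFunctional_printed_two_pi_div_three_eq_conj_pi_div_three_of_symmetric` (a hole symmetric in the row of its
  root rhombus: `VF_{2π/3}(f) = conj VF_{π/3}(ρ_w f)` — the two tables are mirror images; in general they are not).
* §7 ★★ `exists_odd_rayCountAt_of_sum_encircling_ne_zero` / `…_reflected_ne_zero` (∘ `YangBaxterSAWExcursionJordan`'s necessary
  half): A NON-ZERO SIGNED COUNT OF ENCIRCLING HONEYCOMB LOOPS through the two triangles of `f` (of either triangulation)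
  FORCES AN ODD-CROSSING class-`B2a` PLAQUETTE EXCURSION at `f` — the honeycomb winding number and the plaquette crossing
  parity linked through the identities at the two hexagonal angles.
* §8 (edition 4) EVERY ROOT ORIENTATION: the `π/3` hole-root defect at `E`-, `S`-, `N`-rooted holes as encircling sums of the
  half-turned / transposed / anti-transposed triangle domains (`vertexFunctional_printed_pi_div_three_eq_neg_sum_encircling_of_E_root`,
  `…_eq_neg_conj_sum_encircling_of_S_root`, `…_eq_conj_sum_encircling_of_N_root`, dictionary §16 ∘ DCS's hole-root relation),
  their odd-crossing transfers (`exists_odd_rayCountAt_of_sum_encircling_ne_zero_of_E_root/_S_root/_N_root`), and the second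
  angle at every root (`vertexFunctional_printed_two_pi_div_three_of_E_root_eq_conj` — the row reflection of `w` fixes its `E`
  side —, `…_of_S_root_eq_conj` / `…_of_N_root_eq_conj` — it EXCHANGES the `S` and `N` sides: the second angle at an `S`-root is
  the first angle at an `N`-root of the reflected list).
* §9 (edition 5) THE CONE CRITERION at the hexagonal angles: `sum_ne_zero_of_cone` / `add_sum_ne_zero_of_cone` (a one-sided
  cone of complex numbers does not sum to zero) and ★★ `vertexFunctional_printed_pi_div_three_ne_zero_of_cone` /
  `…_two_pi_div_three_ne_zero_of_cone` (if the encircling contributions at the two triangles of `f` lie in an open half-plane and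
  one exists, the defect does not vanish at that hexagonal angle), with the zero-count and odd-crossing corollaries — the mechanism
  behind the lane's «no cancellation» census (FINDING-HEX-NO-CANCELLATION: ≤ 8 of 16 quantised directions per cell).
* §10 (edition 6) ★★ `YBWalk.hvWalk_mem_clsLoop_of_nonCorner_arc`: a Yang–Baxter walk of non-zero `π/3`-weight from the root to a
  side of `f`, arriving from outside and carrying a non-θ-corner arc inside `f`, IS a loop-class honeycomb walk at the triangle of
  `f` across its final side (GM's returning/class-`B2a` walks = DCS's third class, walk by walk; the winding side is left open).

Why (venture lane «pcv-sawmu», Tier B SEARCH 1): the open sufficient half of the lane's encircling criterion is the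
statement «∃ wound walk ⇒ VF ≢ 0 on (π/3, 2π/3)» (`FINDING-YB-ENCIRCLING-CRITERION.md`, STATUS BLOCK 9 (3)); the two
hexagonal angles are the only angles at which the defect has a LOCAL walk expansion (DCS's triangle relations), hence
the only angles where «VF(θ₀) ≠ 0» is a finite signed count of honeycomb loops; §5 turns each of them into a certificate
for «≢ 0» with the tree's zero count. The two tests are independent (different triangulations): the lane's tables show
cells that vanish at `π/3` only and cells that vanish at `2π/3` only (`FINDING-HEX-HOLE-ROOT-DEFECT.md` (ii)).

Design notes. (1) No new definitions: the reflected objects are written out (`Dl.map (mirrorRowFace c)`,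
`mirrorRow c z`, `MirrorWalk.mirrorWalk`), as in the dictionary's §16. (2) For the `W`-rooted statements the reflection is
taken in the row `c = w.2` of the root rhombus, which fixes `w` and its `W` side (`mirrorRowFace_self_row`,
`mirrorRow_side_W_self_row`); §1 is stated for every axis `c`. (3) No analysis beyond the tree's zero count.

References: [GlazmanManolescu2019] §1 (p. 3, Fig. 2; eq. (1) and the remark on `θ ↔ π − θ`), §2.1 (eq. (2.1)), Lemma 2.1
(eq. (2.2) (CR)); [DuminilCopinSmirnov2012] Definition 1, Lemma 1, proof of Lemma 2; [Glazman2015WeightedSAW] §2 (the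
`θ = π/3` case is the hexagonal-lattice walk, as GM19 §1 recalls). Status: CONSOLIDATION / dictionary — new only in
bookkeeping (GM19's hexagonal sentence at the second endpoint `2π/3`, made parafermionic and carried to arbitrary finite
domains with holes; the observable-level dihedral covariance is the tree's `gmObservable` covariance with the winding
phases tracked). Written for the venture lane «pcv-sawmu» (Tier B SEARCH 1, b-engine-1 gen 20). Editions: ed.3 = §1–§7
(landed); ed.4 = ed.3 verbatim ⊕ §8 (appended; landed); ed.5 = ed.4 verbatim ⊕ §9 (appended; landed); ed.6 = ed.5 verbatim ⊕ §10 (appended).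
-/

noncomputable section

open Real

namespace Literature.Probability.RandomPlanarGeometry.SAW.YangBaxter

open MidEdge
open Literature.Barriers.CriticalPhenomena.PlaquetteWalk
open Literature.Barriers.CriticalPhenomena (PlaquetteWalk.dom)

/-! ## §1. The dihedral group acts on the parafermionic observable: the winding phases cancel -/

section Dihedral

/-- The slant potential at constant angle is invariant under the reflection in a row axis (vertical mid-edges go to
vertical ones, slanted to slanted). [cite: GlazmanManolescu2019, §2.1 (the winding of an arc; constant Θ)] -/
theorem slantPot_mirrorRow (c : ℤ) (θ : ℝ) (e : MidEdge) :
    slantPot (fun _ => θ) (mirrorRow c e) = slantPot (fun _ => θ) e := by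
  cases e <;> rfl

/-- The slant potential at constant angle is invariant under the reflection in a column axis.
[cite: GlazmanManolescu2019, §2.1 (the winding of an arc; constant Θ)] -/
theorem slantPot_mirrorCol (c : ℤ) (θ : ℝ) (e : MidEdge) :
    slantPot (fun _ => θ) (mirrorCol c e) = slantPot (fun _ => θ) e := by
  cases e <;> rfl

/-- The slant potential at the dual angle `π − θ` is minus the one at `θ` (`κ_θ = θ − π/2` on slanted mid-edges, `0` on
vertical ones). [cite: GlazmanManolescu2019, §1 (remark after eq. (1): θ ↔ π − θ) and §2.1] -/
theorem slantPot_pi_sub (θ : ℝ) (e : MidEdge) :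
    slantPot (fun _ => π - θ) e = -slantPot (fun _ => θ) e := by
  cases e with
  | vert k j => simp [slantPot]
  | slant k j => simp only [slantPot]; ring

/-- Under the diagonal reflection (vertical ↔ slanted) the two slant potentials of a mid-edge and its image add up
to `θ − π/2`. [cite: GlazmanManolescu2019, §2.1 (the winding of an arc; constant Θ)] -/
theorem slantPot_add_slantPot_mirrorDiag (θ : ℝ) (e : MidEdge) :
    slantPot (fun _ => θ) e + slantPot (fun _ => θ) (mirrorDiag e) = θ - π / 2 := by
  cases e <;> simp [slantPot, mirrorDiag]

/-- **The parafermionic observable of a face list through the catalogue observable**: GM19's `F` (rhombic winding)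
is the square-frame `gmObservable` at the printed weights times the inverse winding-transfer phase
`e^{−i(5/8)(κ(z) − κ(a))}` (the tree's `gmObservable_printed_eq` and `sqParafermionOn_eq`).
[cite: GlazmanManolescu2019, §2.1, eq. (2.1)] -/
theorem parafermionOn_dom_eq_gmObservable_mul (θ : ℝ) (Dl : List Face) (a z : MidEdge) :
    parafermionOn (PlaquetteWalk.dom Dl) a (fun _ => θ) z =
      gmObservable (printedWeights θ) tFiveEighths Dl a z *
        Complex.exp (-((((5 / 8 * (slantPot (fun _ => θ) z - slantPot (fun _ => θ) a) : ℝ)) : ℂ) * Complex.I)) := by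
  rw [gmObservable_printed_eq, sqParafermionOn_eq, mul_assoc, ← Complex.exp_add, add_neg_cancel, Complex.exp_zero,
    mul_one]

/-- ★ **ROW REFLECTIONS ARE ANTI-LINEAR AND EXCHANGE `θ ↔ π − θ` ON THE PARAFERMIONIC OBSERVABLE.** For EVERY finite face
list `Dl`, EVERY root `a`, EVERY mid-edge `z` and EVERY row axis `c`:
`F^{ρDl}_{θ}(ρa → ρz) = conj F^{Dl}_{π−θ}(a → z)` for GM19's observable `F = parafermionOn` (rhombic winding included — the
winding-transfer phases of the root and of the endpoint cancel against the exchange `κ_{π−θ} = −κ_θ`).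
[cite: GlazmanManolescu2019, §2.1, eq. (2.1); §1, eq. (1) (θ ↔ π − θ)]
[cite: DuminilCopinSmirnov2012, proof of Lemma 2 («The symmetry of our domain implies that F(z̄) = F̄(z)»)] -/
theorem parafermionOn_dom_map_mirrorRow_eq_conj (θ : ℝ) (c : ℤ) (Dl : List Face) (a z : MidEdge) :
    parafermionOn (PlaquetteWalk.dom (Dl.map (mirrorRowFace c))) (mirrorRow c a) (fun _ => θ) (mirrorRow c z) =
      (starRingEnd ℂ) (parafermionOn (PlaquetteWalk.dom Dl) a (fun _ => π - θ) z) := by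
  rw [parafermionOn_dom_eq_gmObservable_mul, parafermionOn_dom_eq_gmObservable_mul,
    gmObservable_printed_map_mirrorRow_eq_conj, slantPot_mirrorRow, slantPot_mirrorRow, map_mul]
  congr 1
  rw [← Complex.exp_conj, map_neg, map_mul, Complex.conj_ofReal, Complex.conj_I, slantPot_pi_sub, slantPot_pi_sub]
  congr 1
  push_cast
  ring

/-- ★ **COLUMN REFLECTIONS ARE ANTI-LINEAR AND EXCHANGE `θ ↔ π − θ` ON THE PARAFERMIONIC OBSERVABLE**:
`F^{ρDl}_{θ}(ρa → ρz) = conj F^{Dl}_{π−θ}(a → z)` for the reflection `ρ` in the axis of column `c`.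
[cite: GlazmanManolescu2019, §2.1, eq. (2.1); §1, eq. (1) (θ ↔ π − θ)] -/
theorem parafermionOn_dom_map_mirrorCol_eq_conj (θ : ℝ) (c : ℤ) (Dl : List Face) (a z : MidEdge) :
    parafermionOn (PlaquetteWalk.dom (Dl.map (mirrorColFace c))) (mirrorCol c a) (fun _ => θ) (mirrorCol c z) =
      (starRingEnd ℂ) (parafermionOn (PlaquetteWalk.dom Dl) a (fun _ => π - θ) z) := by
  rw [parafermionOn_dom_eq_gmObservable_mul, parafermionOn_dom_eq_gmObservable_mul,
    gmObservable_printed_map_mirrorCol_eq_conj, slantPot_mirrorCol, slantPot_mirrorCol, map_mul]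
  congr 1
  rw [← Complex.exp_conj, map_neg, map_mul, Complex.conj_ofReal, Complex.conj_I, slantPot_pi_sub, slantPot_pi_sub]
  congr 1
  push_cast
  ring

/-- ★ **THE DIAGONAL REFLECTION IS ANTI-LINEAR AT EVERY FIXED ANGLE ON THE PARAFERMIONIC OBSERVABLE**:
`F^{τDl}_{θ}(τa → τz) = conj F^{Dl}_{θ}(a → z)` — EXACTLY, with no residual phase: the winding-transfer potentials of a
mid-edge and of its transpose add up to the constant `θ − π/2`, at the root and at the endpoint alike.
[cite: GlazmanManolescu2019, §2.1, eq. (2.1); §1, Fig. 4 (the rhombus is symmetric in its θ-diagonal)] -/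
theorem parafermionOn_dom_map_mirrorDiag_eq_conj (θ : ℝ) (Dl : List Face) (a z : MidEdge) :
    parafermionOn (PlaquetteWalk.dom (Dl.map mirrorDiagFace)) (mirrorDiag a) (fun _ => θ) (mirrorDiag z) =
      (starRingEnd ℂ) (parafermionOn (PlaquetteWalk.dom Dl) a (fun _ => θ) z) := by
  rw [parafermionOn_dom_eq_gmObservable_mul, parafermionOn_dom_eq_gmObservable_mul,
    gmObservable_printed_map_mirrorDiag_eq_conj, map_mul]
  congr 1
  rw [← Complex.exp_conj, map_neg, map_mul, Complex.conj_ofReal, Complex.conj_I]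
  have e1 : slantPot (fun _ => θ) (mirrorDiag z) = θ - π / 2 - slantPot (fun _ => θ) z := by
    linarith [slantPot_add_slantPot_mirrorDiag θ z]
  have e2 : slantPot (fun _ => θ) (mirrorDiag a) = θ - π / 2 - slantPot (fun _ => θ) a := by
    linarith [slantPot_add_slantPot_mirrorDiag θ a]
  rw [e1, e2]
  congr 1
  push_cast
  ring

/-- ★ **THE HALF TURN IS AN EXACT LINEAR SYMMETRY OF THE PARAFERMIONIC OBSERVABLE AT EVERY ANGLE**: rotating the face
list, the root and the endpoint by `π` (a column reflection followed by a row reflection) does not change `F_θ`.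
[cite: GlazmanManolescu2019, §2.1, eq. (2.1) and §4.2 (lattice symmetries of G_Θ)] -/
theorem parafermionOn_dom_halfTurn (θ : ℝ) (c c' : ℤ) (Dl : List Face) (a z : MidEdge) :
    parafermionOn (PlaquetteWalk.dom ((Dl.map (mirrorColFace c')).map (mirrorRowFace c)))
        (mirrorRow c (mirrorCol c' a)) (fun _ => θ) (mirrorRow c (mirrorCol c' z)) =
      parafermionOn (PlaquetteWalk.dom Dl) a (fun _ => θ) z := by
  rw [parafermionOn_dom_map_mirrorRow_eq_conj, parafermionOn_dom_map_mirrorCol_eq_conj, sub_sub_cancel,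
    Complex.conj_conj]

/-- **The anti-diagonal reflection (half turn through the origin, then the diagonal) is anti-linear at fixed `θ`**:
`F^{σDl}_{θ}(σa → σz) = conj F^{Dl}_{θ}(a → z)`, `σ(x, y) = (−y, −x)`.
[cite: GlazmanManolescu2019, §2.1, eq. (2.1); §1, Fig. 4] -/
theorem parafermionOn_dom_antiDiag_eq_conj (θ : ℝ) (Dl : List Face) (a z : MidEdge) :
    parafermionOn (PlaquetteWalk.dom (((Dl.map (mirrorColFace 0)).map (mirrorRowFace 0)).map mirrorDiagFace))
        (mirrorDiag (mirrorRow 0 (mirrorCol 0 a))) (fun _ => θ) (mirrorDiag (mirrorRow 0 (mirrorCol 0 z))) =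
      (starRingEnd ℂ) (parafermionOn (PlaquetteWalk.dom Dl) a (fun _ => θ) z) := by
  rw [parafermionOn_dom_map_mirrorDiag_eq_conj, parafermionOn_dom_halfTurn]

end Dihedral


/-! ## §2. The `θ = 2π/3` dictionary, observable level: the honeycomb of the OTHER diagonal -/

section SecondAngle

open HV Literature.Barriers.CriticalPhenomena.PlaquetteWalk.MirrorWalk

/-- `π − π/3 = 2π/3`: the dual angle of the first endpoint of the printed range is the second endpoint. [cite: GlazmanManolescu2019, §1 (remark after eq. (1): θ ↔ π − θ)] -/
theorem pi_sub_pi_div_three : (π - π / 3 : ℝ) = 2 * π / 3 := by ring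

/-- **The printed weights at `2π/3` are the corner-swapped weights at `π/3`** (`u₁ ↔ u₂`, `w₁ ↔ w₂`; in particular
`w₁(2π/3) = w₂(π/3) = 0`). [cite: GlazmanManolescu2019, §1, eq. (1) and the remark after it (θ ↔ π − θ)] -/
theorem printedWeights_two_pi_div_three : printedWeights (2 * π / 3) = (printedWeights (π / 3)).swap := by
  rw [printedWeights_swap, pi_sub_pi_div_three]

/-- The mid-edges of the reflected walk of a face list (MirrorDuality's `mirrorWalkEquivMap`) are the reflected mid-edges.
[cite: GlazmanManolescu2019, §2.1 (walks as sequences of mid-edges)] -/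
theorem mirrorWalkEquivMap_mids (c : ℤ) (Dl : List Face) {a z : MidEdge} (γ : YBWalk (PlaquetteWalk.dom Dl) a z) :
    (mirrorWalkEquivMap c Dl a z γ).mids = γ.mids.map (mirrorRow c) := rfl

/-- **The weight of a walk at `2π/3` is the weight of its row-reflection at `π/3`** (any row axis `c`).
[cite: GlazmanManolescu2019, §1, eq. (1) (θ ↔ π − θ under the corner swap)] -/
theorem YBWalk.weight_two_pi_div_three_eq_weight_mirror (c : ℤ) (Dl : List Face) {a z : MidEdge}
    (γ : YBWalk (PlaquetteWalk.dom Dl) a z) :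
    γ.weight (fun _ => 2 * π / 3) = (mirrorWalkEquivMap c Dl a z γ).weight (fun _ => π / 3) := by
  have h1 := weightL_printedWeights (2 * π / 3) γ
  have h2 := weightL_printedWeights (π / 3) (mirrorWalkEquivMap c Dl a z γ)
  rw [mirrorWalkEquivMap_mids, weightL_map_mirrorRow, ← printedWeights_two_pi_div_three, h1] at h2
  exact_mod_cast h2

/-- ★ **THE WEIGHT CRITERION AT `θ = 2π/3`**: the Yang–Baxter weight of a walk at `2π/3` is non-zero iff the TRIANGLE LIST
OF ITS ROW-REFLECTION is self-avoiding (the dictionary's §10 criterion at `π/3` transported by the reflection; at `2π/3` the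
weight-`0` rhombi are those carrying two `u₁`-arcs, `w₁(2π/3) = 0`). [cite: GlazmanManolescu2019, §1 (θ = π/3 is the hexagonal lattice; θ ↔ π − θ)] -/
theorem YBWalk.weight_two_pi_div_three_ne_zero_iff_nodup (c : ℤ) (Dl : List Face) {a z : MidEdge}
    (γ : YBWalk (PlaquetteWalk.dom Dl) a z) :
    γ.weight (fun _ => 2 * π / 3) ≠ 0 ↔ (mirrorWalkEquivMap c Dl a z γ).hvInner.Nodup := by
  rw [γ.weight_two_pi_div_three_eq_weight_mirror c Dl]
  exact (mirrorWalkEquivMap c Dl a z γ).weight_pi_div_three_ne_zero_iff_nodup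

/-- **The rhombic arc rotation after the row reflection (`N ↔ S`) at angle `θ` is MINUS the rotation at `π − θ`** (all sixteen
ordered side pairs: «the arc from z_W to z_N has winding θ and the arc from z_W to z_S has winding θ − π»).
[cite: GlazmanManolescu2019, §2.1 (the winding of an arc) and §1 (θ ↔ π − θ)] -/
theorem arcTurn_mirrorSide_eq_neg_pi_sub (θ : ℝ) (s t : Side) :
    arcTurn θ (mirrorSide s) (mirrorSide t) = -arcTurn (π - θ) s t := by
  cases s <;> cases t <;> simp [arcTurn, mirrorSide]

/-- The rotation of a reflected arc at constant angle `θ` is minus the rotation of the arc at `π − θ`.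
[cite: GlazmanManolescu2019, §2.1 (the winding of an arc) and §1 (θ ↔ π − θ)] -/
theorem arcTurnOf_mirrorArc_eq_neg_pi_sub (c : ℤ) (θ : ℝ) (p : MidEdge × MidEdge) :
    arcTurnOf (fun _ => θ) (mirrorArc c p) = -arcTurnOf (fun _ => π - θ) p := by
  unfold arcTurnOf
  rw [arcFace_mirrorArc]
  cases hf : arcFace p with
  | none => simp
  | some f =>
    have h1 : (mirrorRowFace c f).sideOf (mirrorArc c p).1 = (f.sideOf p.1).map mirrorSide := sideOf_mirrorRow c f p.1
    have h2 : (mirrorRowFace c f).sideOf (mirrorArc c p).2 = (f.sideOf p.2).map mirrorSide := sideOf_mirrorRow c f p.2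
    simp only [Option.map_some, h1, h2]
    cases f.sideOf p.1 with
    | none => simp
    | some s =>
      cases f.sideOf p.2 with
      | none => simp
      | some t => simpa only [Option.map_some] using arcTurn_mirrorSide_eq_neg_pi_sub θ s t

/-- Summing over a list of arcs: the reflected arcs at `θ` turn by minus the total rotation at `π − θ`. [cite: GlazmanManolescu2019, §2.1 (definition of wind(γ))] -/
theorem sum_map_arcTurnOf_mirrorArc (c : ℤ) (θ : ℝ) (L : List (MidEdge × MidEdge)) :
    ((L.map (mirrorArc c)).map (arcTurnOf fun _ => θ)).sum = -(L.map (arcTurnOf fun _ => π - θ)).sum := by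
  induction L with
  | nil => simp
  | cons p l ih =>
    simp only [List.map_cons, List.sum_cons, arcTurnOf_mirrorArc_eq_neg_pi_sub, ih]
    ring

/-- ★ **THE WINDING DUALITY**: the rhombic winding at angle `θ` of the ROW-REFLECTION of a Yang–Baxter walk is MINUS the
winding of the walk at the dual angle `π − θ` (MirrorDuality's `quarterTurnsL_map_mirrorRow` is the case `θ = π/2`).
[cite: GlazmanManolescu2019, §2.1, eq. (2.1) (wind(γ)) and §1 (θ ↔ π − θ)] -/
theorem YBWalk.winding_mirrorWalk_eq_neg_pi_sub {D D' : Set Face} {a z a' z' : MidEdge} (c : ℤ)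
    (hD : ∀ f, f ∈ D → mirrorRowFace c f ∈ D') (ha : mirrorRow c a = a') (hz : mirrorRow c z = z')
    (γ : YBWalk D a z) (θ : ℝ) :
    (mirrorWalk c hD ha hz γ).winding (fun _ => θ) = -γ.winding (fun _ => π - θ) := by
  show ((arcsOf (γ.mids.map (mirrorRow c))).map (arcTurnOf fun _ => θ)).sum =
    -((arcsOf γ.mids).map (arcTurnOf fun _ => π - θ)).sum
  rw [arcsOf_map_mirrorRow, sum_map_arcTurnOf_mirrorArc]

/-- The winding duality for the reflected walk of a face list (`mirrorWalkEquivMap`).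
[cite: GlazmanManolescu2019, §2.1, eq. (2.1) (wind(γ)) and §1 (θ ↔ π − θ)] -/
theorem YBWalk.winding_mirror_eq_neg_pi_sub (c : ℤ) (Dl : List Face) {a z : MidEdge}
    (γ : YBWalk (PlaquetteWalk.dom Dl) a z) (θ : ℝ) :
    (mirrorWalkEquivMap c Dl a z γ).winding (fun _ => θ) = -γ.winding (fun _ => π - θ) := by
  show ((arcsOf (γ.mids.map (mirrorRow c))).map (arcTurnOf fun _ => θ)).sum =
    -((arcsOf γ.mids).map (arcTurnOf fun _ => π - θ)).sum
  rw [arcsOf_map_mirrorRow, sum_map_arcTurnOf_mirrorArc]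

/-- ★★ **THE WINDING DICTIONARY AT `θ = 2π/3`**: the rhombic winding of a Yang–Baxter walk at `Θ ≡ 2π/3` is MINUS `π/3` times
the honeycomb turning number of the triangle walk of its row-reflection (the dictionary's `winding_pi_div_three_eq_pturn`
transported by the winding duality) — for every walk of every face list, any row axis.
[cite: GlazmanManolescu2019, §2.1, eq. (2.1); §1 (θ = π/3 hexagonal, θ ↔ π − θ)]
[cite: DuminilCopinSmirnov2012, Definition 1 (W_γ, the total rotation in radians)] -/
theorem YBWalk.winding_two_pi_div_three_eq_neg_pturn (c : ℤ) (Dl : List Face) {a z : MidEdge}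
    (γ : YBWalk (PlaquetteWalk.dom Dl) a z) :
    γ.winding (fun _ => 2 * π / 3) = -(π / 3 * HV.pturn (mirrorWalkEquivMap c Dl a z γ).hvWalk) := by
  rw [← YBWalk.winding_pi_div_three_eq_pturn, YBWalk.winding_mirror_eq_neg_pi_sub, pi_sub_pi_div_three,
    neg_neg]

/-- ★ **The parafermionic weight at `2π/3` is the conjugate of the reflected walk's at `π/3`** (equal real weights, opposite
windings). [cite: GlazmanManolescu2019, §2.1, eq. (2.1); §1 (θ ↔ π − θ)] -/
theorem YBWalk.paraWeight_two_pi_div_three_eq_conj (c : ℤ) (Dl : List Face) {a z : MidEdge}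
    (γ : YBWalk (PlaquetteWalk.dom Dl) a z) :
    γ.paraWeight (fun _ => 2 * π / 3) =
      (starRingEnd ℂ) ((mirrorWalkEquivMap c Dl a z γ).paraWeight (fun _ => π / 3)) := by
  rw [YBWalk.paraWeight, YBWalk.paraWeight, map_mul, Complex.conj_ofReal, ← Complex.exp_conj, map_mul,
    Complex.conj_ofReal, Complex.conj_I, γ.weight_two_pi_div_three_eq_weight_mirror c Dl,
    YBWalk.winding_mirror_eq_neg_pi_sub, pi_sub_pi_div_three]
  congr 2
  push_cast
  ring

/-- ★★ **THE PARAFERMIONIC WEIGHT DICTIONARY AT `θ = 2π/3`**: for a walk of non-zero weight,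
`w(γ) e^{−i(5/8)wind_{2π/3}(γ)} = conj (x_c^ℓ λ^{pturn})` of the triangle walk of its row-reflection — Duminil-Copin–Smirnov's
weight, conjugated. [cite: GlazmanManolescu2019, §2.1, eq. (2.1); §1 (θ = π/3 hexagonal, θ ↔ π − θ)]
[cite: DuminilCopinSmirnov2012, Definition 1] -/
theorem YBWalk.paraWeight_two_pi_div_three (c : ℤ) (Dl : List Face) {a z : MidEdge}
    (γ : YBWalk (PlaquetteWalk.dom Dl) a z) (hw : γ.weight (fun _ => 2 * π / 3) ≠ 0) :
    γ.paraWeight (fun _ => 2 * π / 3) = (starRingEnd ℂ) (HV.pwt (mirrorWalkEquivMap c Dl a z γ).hvWalk) := by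
  rw [γ.weight_two_pi_div_three_eq_weight_mirror c Dl] at hw
  rw [γ.paraWeight_two_pi_div_three_eq_conj c Dl, (mirrorWalkEquivMap c Dl a z γ).paraWeight_pi_div_three hw]

/-- The reflection in the row of the origin fixes the origin mid-edge. [cite: GlazmanManolescu2019, §1 (the lattice of rhombi and its mid-edges)] -/
theorem mirrorRow_zero_origin : mirrorRow 0 origin = origin := by
  simp [mirrorRow, origin]

/-- The western neighbour of the origin rhombus stays outside the reflected list. [folklore]
[cite: GlazmanManolescu2019, §1 (the lattice of rhombi and its mid-edges)] -/
theorem neg_one_zero_not_mem_map_mirrorRowFace_zero {Dl : List Face} (hD : ((-1 : ℤ), (0 : ℤ)) ∉ Dl) :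
    ((-1 : ℤ), (0 : ℤ)) ∉ Dl.map (mirrorRowFace 0) := by
  rw [List.mem_map]
  rintro ⟨g, hg, he⟩
  obtain ⟨k, j⟩ := g
  simp only [mirrorRowFace, Prod.mk.injEq] at he
  have : ((k, j) : Face) = (-1, 0) := by ext <;> simp <;> omega
  exact hD (this ▸ hg)

/-- ★★ **THE OBSERVABLE IDENTITY AT `θ = 2π/3` (root at the origin).** For every finite face list `Dl` not containing
`(−1, 0)` and every mid-edge `z`, Glazman–Manolescu's parafermionic observable at `Θ ≡ 2π/3` is the COMPLEX CONJUGATE of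
Duminil-Copin–Smirnov's honeycomb observable of the triangle domain of the ROW-REFLECTED list `ρ₀Dl` (reflection in the
row of the origin rhombus, which fixes the root) at the reflected side `ρ₀z`:
`F_{Dl}(0; z)|_{2π/3} = conj F_hex(triSet ρ₀Dl; ρ₀z)`. Pulled back by `ρ₀`, the triangles of `ρ₀Dl` are the triangles of
the OTHER diagonal of each rhombus of `Dl` — the honeycomb lattice GM19's sentence assigns to the angle `2π/3`.
[cite: GlazmanManolescu2019, §1 («H(Θ) becomes a triangular lattice … the hexagonal lattice»; θ ↔ π − θ) and §2.1, eq. (2.1)]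
[cite: DuminilCopinSmirnov2012, Definition 1 and proof of Lemma 2 («F(z̄) = F̄(z)»)] -/
theorem parafermionOn_two_pi_div_three_eq_conj_hexObservableAt (Dl : List Face) (hD : ((-1 : ℤ), (0 : ℤ)) ∉ Dl)
    (z : MidEdge) :
    parafermionOn (PlaquetteWalk.dom Dl) origin (fun _ => 2 * π / 3) z =
      (starRingEnd ℂ) (hexObservableAt (triSet (Dl.map (mirrorRowFace 0)).toFinset) (mirrorRow 0 z)) := by
  have h := parafermionOn_dom_map_mirrorRow_eq_conj (π / 3) 0 Dl origin z
  rw [mirrorRow_zero_origin, pi_sub_pi_div_three] at h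
  have hD' : ((-1 : ℤ), (0 : ℤ)) ∉ PlaquetteWalk.dom (Dl.map (mirrorRowFace 0)) :=
    neg_one_zero_not_mem_map_mirrorRowFace_zero hD
  rw [parafermionOn_pi_div_three_eq_hexObservableAt _ (Dl.map (mirrorRowFace 0)).toFinset
    (fun g => by simp [PlaquetteWalk.dom]) hD'] at h
  have h' := congrArg (starRingEnd ℂ) h
  rw [Complex.conj_conj] at h'
  exact h'.symm

/-- The reflection in the row of a rhombus fixes that rhombus. [cite: GlazmanManolescu2019, §1 (the lattice of rhombi and its mid-edges)] -/
theorem mirrorRowFace_self_row (w : Face) : mirrorRowFace w.2 w = w := by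
  obtain ⟨k, j⟩ := w
  show ((k, 2 * j - j) : Face) = (k, j)
  congr 1
  ring

/-- The reflection in the row of a rhombus fixes its `W` side. [cite: GlazmanManolescu2019, §1, Fig. 4 (z_W)] -/
theorem mirrorRow_side_W_self_row (w : Face) : mirrorRow w.2 (w.side .W) = w.side .W := by
  rw [mirrorRow_side, mirrorRowFace_self_row]
  rfl

/-- The western neighbour of `w` stays outside the list reflected in the row of `w`. [folklore]
[cite: GlazmanManolescu2019, §1 (the lattice of rhombi and its mid-edges)] -/
theorem holeW_not_mem_map_mirrorRowFace_self_row {Dl : List Face} {w : Face} (hw : ((w.1 - 1 : ℤ), w.2) ∉ Dl) :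
    ((w.1 - 1 : ℤ), w.2) ∉ Dl.map (mirrorRowFace w.2) := by
  rw [List.mem_map]
  rintro ⟨g, hg, he⟩
  obtain ⟨k, j⟩ := g
  simp only [mirrorRowFace, Prod.mk.injEq] at he
  have : ((k, j) : Face) = (w.1 - 1, w.2) := by ext <;> simp <;> omega
  exact hw (this ▸ hg)

/-- ★★ **THE OBSERVABLE IDENTITY AT `θ = 2π/3` FROM ANY `W`-ROOT.** For a finite face list `Dl`, a root on the `W` side of a
rhombus `w` whose western neighbour is outside `Dl`, and every mid-edge `z`: `F_{Dl}(w.side W; z)` at `Θ ≡ 2π/3` is the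
complex conjugate of DCS's observable of the translated triangle domain of the list REFLECTED IN THE ROW OF `w` (the
reflection fixes the root; translation by `−w` puts it at the honeycomb files' origin) at the reflected, translated side.
[cite: GlazmanManolescu2019, §1 (θ = π/3 hexagonal; θ ↔ π − θ), §2.1 and §4.2] [cite: DuminilCopinSmirnov2012, Definition 1] -/
theorem parafermionOn_two_pi_div_three_eq_conj_hexObservableAt_of_W_root (Dl : List Face) (w : Face)
    (hw : ((w.1 - 1 : ℤ), w.2) ∉ Dl) (z : MidEdge) :
    parafermionOn (PlaquetteWalk.dom Dl) (w.side .W) (fun _ => 2 * π / 3) z =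
      (starRingEnd ℂ) (hexObservableAt (triSet ((Dl.map (mirrorRowFace w.2)).map (Face.shiftBy (-w))).toFinset)
        ((mirrorRow w.2 z).shiftBy (-w))) := by
  have h := parafermionOn_dom_map_mirrorRow_eq_conj (π / 3) w.2 Dl (w.side .W) z
  rw [mirrorRow_side_W_self_row, pi_sub_pi_div_three,
    parafermionOn_pi_div_three_eq_hexObservableAt_of_W_root _ w (holeW_not_mem_map_mirrorRowFace_self_row hw)] at h
  have h' := congrArg (starRingEnd ℂ) h
  rw [Complex.conj_conj] at h'
  exact h'.symm

end SecondAngle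

/-! ## §3. The vertex functional and the hole-root defect at `θ = 2π/3` -/

section SecondAngleDefect

open HV

/-- **Mirror duality read at the second endpoint**: `VF_{2π/3}(Dl; a; f) = conj VF_{π/3}(ρDl; ρa; ρf)` for the reflection
`ρ` in ANY row axis `c` (MirrorDuality's `θ ↔ π − θ` for every domain, with `ρρ = 1`).
[cite: GlazmanManolescu2019, Lemma 2.1, eq. (2.2) (CR); §1, eq. (1) (θ ↔ π − θ)] -/
theorem vertexFunctional_printed_two_pi_div_three_eq_conj_map_mirrorRow (c : ℤ) (Dl : List Face) (a : MidEdge)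
    (f : Face) :
    vertexFunctional (printedWeights (2 * π / 3)) tFiveEighths (ybCoeff (2 * π / 3)) Dl a f =
      (starRingEnd ℂ) (vertexFunctional (printedWeights (π / 3)) tFiveEighths (ybCoeff (π / 3))
        (Dl.map (mirrorRowFace c)) (mirrorRow c a) (mirrorRowFace c f)) := by
  rw [vertexFunctional_printed_map_mirrorRow_duality, pi_sub_pi_div_three, Complex.conj_conj]

/-- The same with the reflection in the row of the root rhombus `w`, which fixes the root `w.side W`.
[cite: GlazmanManolescu2019, Lemma 2.1, eq. (2.2) (CR); §1, eq. (1) (θ ↔ π − θ)] -/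
theorem vertexFunctional_printed_two_pi_div_three_eq_conj_mirror_self_row (Dl : List Face) (w : Face) (f : Face) :
    vertexFunctional (printedWeights (2 * π / 3)) tFiveEighths (ybCoeff (2 * π / 3)) Dl (w.side .W) f =
      (starRingEnd ℂ) (vertexFunctional (printedWeights (π / 3)) tFiveEighths (ybCoeff (π / 3))
        (Dl.map (mirrorRowFace w.2)) (w.side .W) (mirrorRowFace w.2 f)) := by
  rw [vertexFunctional_printed_two_pi_div_three_eq_conj_map_mirrorRow w.2, mirrorRow_side_W_self_row]

/-- ★★ **THE VERTEX FUNCTIONAL AT `θ = 2π/3` FROM ANY `W`-ROOT** is MINUS THE CONJUGATE of the sum of Duminil-Copin–Smirnov's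
two triangle relations at the reflected rhombus `ρ_w f` in the triangle domain of the reflected, translated list:
`(2ω − 1)·VF_{2π/3}(Dl; w.side W; f) = −conj Σ_{P} (c_{T₁'}(P) + c_{T₂'}(P))`, `T₁' = (ρ_w f − w).hv W`, `T₂' = (ρ_w f − w).hv E`
(the factor `2ω − 1 = i√3` is imaginary, whence the sign). [cite: GlazmanManolescu2019, §1 (θ = π/3; θ ↔ π − θ), Lemma 2.1]
[cite: DuminilCopinSmirnov2012, Lemma 1] -/
theorem vertexFunctional_printed_two_pi_div_three_eq_neg_conj_sum_cv_of_W_root (Dl : List Face) (w : Face)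
    (hw : ((w.1 - 1 : ℤ), w.2) ∉ Dl) (f : Face) :
    (2 * omg - 1) *
        vertexFunctional (printedWeights (2 * π / 3)) tFiveEighths (ybCoeff (2 * π / 3)) Dl (w.side .W) f =
      -(starRingEnd ℂ) (∑ P ∈ midWalks (triSet ((Dl.map (mirrorRowFace w.2)).map (Face.shiftBy (-w))).toFinset),
        (cv ((Face.shiftBy (-w) (mirrorRowFace w.2 f)).hv .W) P + cv ((Face.shiftBy (-w) (mirrorRowFace w.2 f)).hv .E) P)) := by
  have hW := vertexFunctional_printed_pi_div_three_eq_sum_cv_of_W_root (Dl.map (mirrorRowFace w.2)) w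
    (holeW_not_mem_map_mirrorRowFace_self_row hw) (mirrorRowFace w.2 f)
  have hc := congrArg (starRingEnd ℂ) hW
  rw [map_mul, conj_two_mul_omg_sub_one] at hc
  rw [vertexFunctional_printed_two_pi_div_three_eq_conj_mirror_self_row]
  linear_combination -hc

/-- ★ **GM19's (CR) contour form at `θ = 2π/3` through DCS's observable** (root at the origin):
`VF_{2π/3}(Dl; 0; f) = conj (Σ_s crCoef(π/3) s · F_hex(triSet ρ₀Dl; (ρ₀f).side s))`.
[cite: GlazmanManolescu2019, Lemma 2.1, eq. (CR); §1 (θ ↔ π − θ)] [cite: DuminilCopinSmirnov2012, Definition 1] -/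
theorem vertexFunctional_printed_two_pi_div_three_eq_conj_sum_crCoef (Dl : List Face) (hD : ((-1 : ℤ), (0 : ℤ)) ∉ Dl)
    (f : Face) :
    vertexFunctional (printedWeights (2 * π / 3)) tFiveEighths (ybCoeff (2 * π / 3)) Dl origin f =
      (starRingEnd ℂ) (∑ s : Side, crCoef (π / 3) s *
        hexObservableAt (triSet (Dl.map (mirrorRowFace 0)).toFinset) ((mirrorRowFace 0 f).side s)) := by
  rw [vertexFunctional_printed_two_pi_div_three_eq_conj_map_mirrorRow 0, mirrorRow_zero_origin,
    vertexFunctional_printed_pi_div_three_eq_sum_crCoef _ (neg_one_zero_not_mem_map_mirrorRowFace_zero hD)]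

/-- ★★ **THE YANG–BAXTER DEFECT AT `θ = 2π/3` = MINUS THE CONJUGATE OF THE ENCIRCLING HONEYCOMB LOOPS OF THE REFLECTED
TRIANGLE DOMAIN.** For a finite face list `Dl` rooted on the `W` side of a rhombus `w` (western neighbour outside), at EVERY
rhombus `f ∈ Dl`: with `V' = triSet (ρ_w Dl − w)` and `T₁' = (ρ_w f − w).hv W`, `T₂' = (ρ_w f − w).hv E`,
`(2ω − 1)·VF_{2π/3}(Dl; w.side W; f) = −conj [Σ_{γ ∈ loop class of V' at T₁', loop winds about the root face} dir·x_c^ℓ λ^{pturn}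
+ (same at T₂')]` (the dictionary's §15 at `π/3` for the reflected list, transported by MirrorDuality). For an outer root no
loop winds and the right-hand side is `0`; for a hole root this is the explicit walk expansion of the defect at the second
hexagonal angle — on the honeycomb of the OTHER diagonal. [cite: GlazmanManolescu2019, §1 (θ = π/3; θ ↔ π − θ), Lemma 2.1]
[cite: DuminilCopinSmirnov2012, Lemma 1 and its proof («we used the fact that a is on the boundary and Ω is simply connected»)] -/
theorem vertexFunctional_printed_two_pi_div_three_eq_neg_conj_sum_encircling (Dl : List Face) (w : Face)
    (hw : ((w.1 - 1 : ℤ), w.2) ∉ Dl) {f : Face} (hf : f ∈ Dl) :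
    (2 * omg - 1) *
        vertexFunctional (printedWeights (2 * π / 3)) tFiveEighths (ybCoeff (2 * π / 3)) Dl (w.side .W) f =
      -(starRingEnd ℂ)
        ((∑ P ∈ (clsLoop (triSet ((Dl.map (mirrorRowFace w.2)).map (Face.shiftBy (-w))).toFinset)
              ((Face.shiftBy (-w) (mirrorRowFace w.2 f)).hv .W)).filter
            (fun P => loopWnd ((Face.shiftBy (-w) (mirrorRowFace w.2 f)).hv .W) P ≠ 0),
          edir ((Face.shiftBy (-w) (mirrorRowFace w.2 f)).hv .W) (finalDart P).1 * pwt P) +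
        (∑ P ∈ (clsLoop (triSet ((Dl.map (mirrorRowFace w.2)).map (Face.shiftBy (-w))).toFinset)
              ((Face.shiftBy (-w) (mirrorRowFace w.2 f)).hv .E)).filter
            (fun P => loopWnd ((Face.shiftBy (-w) (mirrorRowFace w.2 f)).hv .E) P ≠ 0),
          edir ((Face.shiftBy (-w) (mirrorRowFace w.2 f)).hv .E) (finalDart P).1 * pwt P)) := by
  have hf' : mirrorRowFace w.2 f ∈ Dl.map (mirrorRowFace w.2) := List.mem_map.2 ⟨f, hf, rfl⟩
  have hW := vertexFunctional_printed_pi_div_three_eq_sum_encircling (Dl.map (mirrorRowFace w.2)) w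
    (holeW_not_mem_map_mirrorRowFace_self_row hw) hf'
  have hc := congrArg (starRingEnd ℂ) hW
  rw [map_mul, conj_two_mul_omg_sub_one] at hc
  rw [vertexFunctional_printed_two_pi_div_three_eq_conj_mirror_self_row]
  linear_combination -hc

/-- ★ **Corollary: if no honeycomb loop of the REFLECTED triangle domain through the two triangles `T₁', T₂'` winds about
the root face, the Yang–Baxter relation holds at `f` at `θ = 2π/3`** — the lane's «2π/3-only» endpoint zeros (cells that
no encircling loop of the other triangulation can pass), and every rhombus for an outer root.
[cite: GlazmanManolescu2019, Lemma 2.1] [cite: DuminilCopinSmirnov2012, Lemma 1] -/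
theorem vertexFunctional_printed_two_pi_div_three_eq_zero_of_loopWnd (Dl : List Face) (w : Face)
    (hw : ((w.1 - 1 : ℤ), w.2) ∉ Dl) {f : Face} (hf : f ∈ Dl)
    (h₁ : ∀ P ∈ clsLoop (triSet ((Dl.map (mirrorRowFace w.2)).map (Face.shiftBy (-w))).toFinset)
        ((Face.shiftBy (-w) (mirrorRowFace w.2 f)).hv .W),
      loopWnd ((Face.shiftBy (-w) (mirrorRowFace w.2 f)).hv .W) P = 0)
    (h₂ : ∀ P ∈ clsLoop (triSet ((Dl.map (mirrorRowFace w.2)).map (Face.shiftBy (-w))).toFinset)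
        ((Face.shiftBy (-w) (mirrorRowFace w.2 f)).hv .E),
      loopWnd ((Face.shiftBy (-w) (mirrorRowFace w.2 f)).hv .E) P = 0) :
    vertexFunctional (printedWeights (2 * π / 3)) tFiveEighths (ybCoeff (2 * π / 3)) Dl (w.side .W) f = 0 := by
  have h := vertexFunctional_printed_two_pi_div_three_eq_neg_conj_sum_encircling Dl w hw hf
  rw [Finset.sum_eq_zero (fun P hP => ?_), Finset.sum_eq_zero (fun P hP => ?_), add_zero, map_zero, neg_zero] at h
  · exact (mul_eq_zero.1 h).resolve_left two_mul_omg_sub_one_ne_zero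
  · obtain ⟨hP, hz⟩ := Finset.mem_filter.1 hP; exact absurd (h₂ P hP) hz
  · obtain ⟨hP, hz⟩ := Finset.mem_filter.1 hP; exact absurd (h₁ P hP) hz

/-- ★ **MIRROR DUALITY OF THE BOUNDARY FLUX, every domain**: the boundary sum of the (CR)-weighted observable (the lane's
`boundarySum`: outer boundary and hole boundaries, root term included) of the REFLECTED list at angle `θ` is the conjugate of
the boundary sum of the list at `π − θ` (discrete Stokes `Σ_f VF = boundarySum` on both sides and MirrorDuality face by face).
[cite: GlazmanManolescu2019, Lemma 2.2 (stated from [Gl, Lem. 4.1]); §1, eq. (1) (θ ↔ π − θ)]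
[cite: DuminilCopinSmirnov2012, proof of Lemma 2 («Values at interior mid-edges disappear»; «F(z̄) = F̄(z)»)] -/
theorem boundarySum_printed_map_mirrorRow_duality (θ : ℝ) (c : ℤ) (Dl : List Face) (a : MidEdge) :
    boundarySum (printedWeights θ) tFiveEighths (ybCoeff θ) (Dl.map (mirrorRowFace c)) (mirrorRow c a) =
      (starRingEnd ℂ) (boundarySum (printedWeights (π - θ)) tFiveEighths (ybCoeff (π - θ)) Dl a) := by
  classical
  rw [← sum_vertexFunctional_printed_eq_boundarySum, ← sum_vertexFunctional_printed_eq_boundarySum, map_sum]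
  have himg : (Dl.map (mirrorRowFace c)).toFinset = Dl.toFinset.image (mirrorRowFace c) := by
    ext f
    simp only [List.mem_toFinset, List.mem_map, Finset.mem_image]
  rw [himg, Finset.sum_image (fun x _ y _ h => mirrorRowFace_injective c h)]
  exact Finset.sum_congr rfl fun f _ => vertexFunctional_printed_map_mirrorRow_duality θ c Dl a f

/-- The boundary flux at `2π/3` from a `W`-root is the conjugate of the boundary flux at `π/3` of the list reflected in the
row of the root rhombus. [cite: GlazmanManolescu2019, Lemma 2.2; §1 (θ ↔ π − θ)] -/
theorem boundarySum_printed_two_pi_div_three_eq_conj_mirror_self_row (Dl : List Face) (w : Face) :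
    boundarySum (printedWeights (2 * π / 3)) tFiveEighths (ybCoeff (2 * π / 3)) Dl (w.side .W) =
      (starRingEnd ℂ) (boundarySum (printedWeights (π / 3)) tFiveEighths (ybCoeff (π / 3))
        (Dl.map (mirrorRowFace w.2)) (w.side .W)) := by
  have h := boundarySum_printed_map_mirrorRow_duality (π / 3) w.2 Dl (w.side .W)
  rw [mirrorRow_side_W_self_row, pi_sub_pi_div_three] at h
  rw [h, Complex.conj_conj]

/-- ★★ **TOTAL ENCIRCLING WEIGHT OF THE OTHER TRIANGULATION = BOUNDARY FLUX AT `θ = 2π/3`.** For every finite face list `Dl`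
rooted on the `W` side of a rhombus `w` (western neighbour outside), `(2ω − 1)` times the boundary sum of Glazman–Manolescu's
observable at `2π/3` equals MINUS THE CONJUGATE of the sum over all rhombi `f'` of the reflected list `ρ_w Dl` of the signed
weights of the honeycomb loop-class walks (of the reflected, translated triangle domain) through the two triangles of `f' − w`
that wind about the root face (the dictionary's §17 at `π/3` for `ρ_w Dl`, transported). For an outer root both sides vanish.
[cite: GlazmanManolescu2019, Lemma 2.2 (stated from [Gl, Lem. 4.1]); §1 (θ = π/3, θ ↔ π − θ)]
[cite: DuminilCopinSmirnov2012, proof of Lemma 2 («Values at interior mid-edges disappear»)] -/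
theorem boundarySum_printed_two_pi_div_three_eq_neg_conj_sum_encircling (Dl : List Face) (w : Face)
    (hw : ((w.1 - 1 : ℤ), w.2) ∉ Dl) :
    (2 * omg - 1) * boundarySum (printedWeights (2 * π / 3)) tFiveEighths (ybCoeff (2 * π / 3)) Dl (w.side .W) =
      -(starRingEnd ℂ) (∑ f ∈ (Dl.map (mirrorRowFace w.2)).toFinset,
        ((∑ P ∈ (clsLoop (triSet ((Dl.map (mirrorRowFace w.2)).map (Face.shiftBy (-w))).toFinset)
              ((Face.shiftBy (-w) f).hv .W)).filter (fun P => loopWnd ((Face.shiftBy (-w) f).hv .W) P ≠ 0),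
          edir ((Face.shiftBy (-w) f).hv .W) (finalDart P).1 * pwt P) +
        (∑ P ∈ (clsLoop (triSet ((Dl.map (mirrorRowFace w.2)).map (Face.shiftBy (-w))).toFinset)
              ((Face.shiftBy (-w) f).hv .E)).filter (fun P => loopWnd ((Face.shiftBy (-w) f).hv .E) P ≠ 0),
          edir ((Face.shiftBy (-w) f).hv .E) (finalDart P).1 * pwt P))) := by
  have hW := boundarySum_printed_pi_div_three_eq_sum_encircling (Dl.map (mirrorRowFace w.2)) w
    (holeW_not_mem_map_mirrorRowFace_self_row hw)
  have hc := congrArg (starRingEnd ℂ) hW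
  rw [map_mul, conj_two_mul_omg_sub_one] at hc
  rw [boundarySum_printed_two_pi_div_three_eq_conj_mirror_self_row]
  linear_combination -hc

end SecondAngleDefect


/-! ## §4. The observable at `E`-, `S`- and `N`-rooted rhombi at `θ = π/3` (observable-level companions of the dictionary's
§16, through §1) -/

section Roots

open HV

/-- ★ **THE OBSERVABLE IDENTITY AT AN `E`-ROOTED RHOMBUS** (root on the `E` side of `w`, eastern neighbour `(w.1 + 1, w.2)`
outside the list): `F_{Dl}(w.side E; z)` at `Θ ≡ π/3` is DCS's observable of the triangle domain of the HALF-TURNED list `−Dl`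
re-rooted at `−w` (a `W`-root) and translated to the origin, at the image side — the half turn being an exact LINEAR
symmetry of the observable (§1). [cite: GlazmanManolescu2019, §1 (θ = π/3 hexagonal), §2.1, §4.2 (lattice symmetries)]
[cite: DuminilCopinSmirnov2012, Definition 1] -/
theorem parafermionOn_pi_div_three_eq_hexObservableAt_of_E_root (Dl : List Face) (w : Face)
    (hw : ((w.1 + 1 : ℤ), w.2) ∉ Dl) (z : MidEdge) :
    parafermionOn (PlaquetteWalk.dom Dl) (w.side .E) (fun _ => π / 3) z =
      hexObservableAt (triSet (((Dl.map (mirrorColFace 0)).map (mirrorRowFace 0)).map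
          (Face.shiftBy (-(((-w.1 : ℤ), (-w.2 : ℤ)) : Face)))).toFinset)
        ((mirrorRow 0 (mirrorCol 0 z)).shiftBy (-(((-w.1 : ℤ), (-w.2 : ℤ)) : Face))) := by
  have hw' : (((((-w.1 : ℤ), (-w.2 : ℤ)) : Face).1 - 1 : ℤ), (((-w.1 : ℤ), (-w.2 : ℤ)) : Face).2) ∉
      (Dl.map (mirrorColFace 0)).map (mirrorRowFace 0) := by
    rw [List.map_map, List.mem_map]
    rintro ⟨g, hg, he⟩
    obtain ⟨k, j⟩ := g
    simp only [Function.comp_apply, mirrorColFace, mirrorRowFace, Prod.mk.injEq] at he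
    obtain ⟨h1, h2⟩ := he
    have hk : k = w.1 + 1 := by omega
    have hj : j = w.2 := by omega
    subst hk; subst hj
    exact hw hg
  rw [← parafermionOn_dom_halfTurn (π / 3) 0 0 Dl (w.side .E) z, halfTurn_side_E]
  exact parafermionOn_pi_div_three_eq_hexObservableAt_of_W_root _ _ hw' _

/-- ★ **THE OBSERVABLE IDENTITY AT AN `S`-ROOTED RHOMBUS** (root on the `S` side of `w`, southern neighbour `(w.1, w.2 − 1)`
outside the list): `F_{Dl}(w.side S; z)` at `Θ ≡ π/3` is the COMPLEX CONJUGATE of DCS's observable of the triangle domain of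
the TRANSPOSED list `τDl` (re-rooted at `τw = (w.2, w.1)`, a `W`-root, translated to the origin) at the image side — the
diagonal reflection being anti-linear at fixed angle (§1). [cite: GlazmanManolescu2019, §1 (θ = π/3 hexagonal), §2.1, Fig. 4]
[cite: DuminilCopinSmirnov2012, Definition 1 and proof of Lemma 2 («F(z̄) = F̄(z)»)] -/
theorem parafermionOn_pi_div_three_eq_conj_hexObservableAt_of_S_root (Dl : List Face) (w : Face)
    (hw : (w.1, (w.2 - 1 : ℤ)) ∉ Dl) (z : MidEdge) :
    parafermionOn (PlaquetteWalk.dom Dl) (w.side .S) (fun _ => π / 3) z =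
      (starRingEnd ℂ) (hexObservableAt
        (triSet ((Dl.map mirrorDiagFace).map (Face.shiftBy (-((w.2, w.1) : Face)))).toFinset)
        ((mirrorDiag z).shiftBy (-((w.2, w.1) : Face)))) := by
  have hw' : ((((w.2, w.1) : Face).1 - 1 : ℤ), ((w.2, w.1) : Face).2) ∉ Dl.map mirrorDiagFace := by
    rw [List.mem_map]
    rintro ⟨g, hg, he⟩
    obtain ⟨k, j⟩ := g
    simp only [mirrorDiagFace, Prod.mk.injEq] at he
    obtain ⟨h1, h2⟩ := he
    subst h2
    have hj : j = w.2 - 1 := by omega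
    subst hj
    exact hw hg
  have h := parafermionOn_dom_map_mirrorDiag_eq_conj (π / 3) Dl (w.side .S) z
  rw [mirrorDiag_side_S, parafermionOn_pi_div_three_eq_hexObservableAt_of_W_root _ _ hw'] at h
  have h' := congrArg (starRingEnd ℂ) h
  rw [Complex.conj_conj] at h'
  exact h'.symm

/-- ★ **THE OBSERVABLE IDENTITY AT AN `N`-ROOTED RHOMBUS** (root on the `N` side of `w`, northern neighbour `(w.1, w.2 + 1)`
outside the list): `F_{Dl}(w.side N; z)` at `Θ ≡ π/3` is the complex conjugate of DCS's observable of the triangle domain of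
the ANTI-TRANSPOSED list `σDl` (`σ(x, y) = (−y, −x)`, re-rooted at `σw`, a `W`-root, translated to the origin) at the image
side (§1: half turn, then diagonal). [cite: GlazmanManolescu2019, §1 (θ = π/3 hexagonal), §2.1, Fig. 4]
[cite: DuminilCopinSmirnov2012, Definition 1 and proof of Lemma 2 («F(z̄) = F̄(z)»)] -/
theorem parafermionOn_pi_div_three_eq_conj_hexObservableAt_of_N_root (Dl : List Face) (w : Face)
    (hw : (w.1, (w.2 + 1 : ℤ)) ∉ Dl) (z : MidEdge) :
    parafermionOn (PlaquetteWalk.dom Dl) (w.side .N) (fun _ => π / 3) z =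
      (starRingEnd ℂ) (hexObservableAt
        (triSet ((((Dl.map (mirrorColFace 0)).map (mirrorRowFace 0)).map mirrorDiagFace).map
          (Face.shiftBy (-(((-w.2 : ℤ), (-w.1 : ℤ)) : Face)))).toFinset)
        ((mirrorDiag (mirrorRow 0 (mirrorCol 0 z))).shiftBy (-(((-w.2 : ℤ), (-w.1 : ℤ)) : Face)))) := by
  have hw' : (((((-w.2 : ℤ), (-w.1 : ℤ)) : Face).1 - 1 : ℤ), (((-w.2 : ℤ), (-w.1 : ℤ)) : Face).2) ∉
      ((Dl.map (mirrorColFace 0)).map (mirrorRowFace 0)).map mirrorDiagFace := by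
    rw [List.map_map, List.map_map, List.mem_map]
    rintro ⟨g, hg, he⟩
    obtain ⟨k, j⟩ := g
    simp only [Function.comp_apply, mirrorColFace, mirrorRowFace, mirrorDiagFace, Prod.mk.injEq] at he
    obtain ⟨h1, h2⟩ := he
    have hk : k = w.1 := by omega
    have hj : j = w.2 + 1 := by omega
    subst hk; subst hj
    exact hw hg
  have h := parafermionOn_dom_antiDiag_eq_conj (π / 3) Dl (w.side .N) z
  rw [antiDiag_side_N, parafermionOn_pi_div_three_eq_hexObservableAt_of_W_root _ _ hw'] at h
  have h' := congrArg (starRingEnd ℂ) h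
  rw [Complex.conj_conj] at h'
  exact h'.symm

end Roots

/-! ## §5. Both hexagonal angles as exact tests for «the defect does not vanish identically» (composition with the tree's
zero count `PlaquetteWalkAngleZeroCount`) -/

section Tests

open HV

/-- `π/3 ∈ (0, π)`: the first hexagonal endpoint lies in the open range of the weights. [cite: GlazmanManolescu2019, §1 (θ ∈ [π/3, 2π/3])] -/
theorem pi_div_three_mem_Ioo : (π / 3 : ℝ) ∈ Set.Ioo 0 π :=
  ⟨by positivity, by linarith [Real.pi_pos]⟩

/-- `2π/3 ∈ (0, π)`: the second hexagonal endpoint lies in the open range of the weights. [cite: GlazmanManolescu2019, §1 (θ ∈ [π/3, 2π/3])] -/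
theorem two_pi_div_three_mem_Ioo : (2 * π / 3 : ℝ) ∈ Set.Ioo 0 π :=
  ⟨by positivity, by linarith [Real.pi_pos]⟩

/-- **A non-zero value at either hexagonal endpoint certifies finitely many zero angles, with the tree's count**: if
`VF(π/3) ≠ 0` or `VF(2π/3) ≠ 0` then the zero set of `θ ↦ VF_{Dl}(a, f₀; θ)` in `(0, π)` is finite with at most `4K + 1`
elements, `K = maxExp Dl a f₀` (`PlaquetteWalkAngleZeroCount.vertexFunctional_printed_zero_count`).
[cite: GlazmanManolescu2019, §1, eq. (1) (the weights are trigonometric in θ) and Lemma 2.1] -/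
theorem vertexFunctional_printed_zero_set_of_endpoint_ne_zero (Dl : List Face) (a : MidEdge) (f₀ : Face)
    (h : vertexFunctional (printedWeights (π / 3)) tFiveEighths (ybCoeff (π / 3)) Dl a f₀ ≠ 0 ∨
      vertexFunctional (printedWeights (2 * π / 3)) tFiveEighths (ybCoeff (2 * π / 3)) Dl a f₀ ≠ 0) :
    {θ ∈ Set.Ioo 0 π | vertexFunctional (printedWeights θ) tFiveEighths (ybCoeff θ) Dl a f₀ = 0}.Finite ∧
      {θ ∈ Set.Ioo 0 π | vertexFunctional (printedWeights θ) tFiveEighths (ybCoeff θ) Dl a f₀ = 0}.ncard ≤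
        4 * maxExp Dl a f₀ + 1 := by
  rcases vertexFunctional_printed_zero_count Dl a f₀ with hall | hfin
  · rcases h with h | h
    · exact absurd (hall _ pi_div_three_mem_Ioo) h
    · exact absurd (hall _ two_pi_div_three_mem_Ioo) h
  · exact hfin

/-- ★ **THE `π/3` TEST.** For a `W`-rooted hole root (western neighbour of `w` outside `Dl`) and `f ∈ Dl`: if the signed weight
of the honeycomb loop-class walks through the two triangles of `f − w` that wind about the root face is NON-ZERO (a finite
signed count of self-avoiding honeycomb loops, computable in principle), then the Yang–Baxter defect `θ ↦ VF_{Dl}(w.side W; f; θ)`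
vanishes at AT MOST `4K + 1` angles of `(0, π)` — in particular it is not identically zero on the printed range.
[cite: GlazmanManolescu2019, §1 (θ = π/3), Lemma 2.1] [cite: DuminilCopinSmirnov2012, Lemma 1] -/
theorem vertexFunctional_printed_zero_set_of_sum_encircling_ne_zero (Dl : List Face) (w : Face)
    (hw : ((w.1 - 1 : ℤ), w.2) ∉ Dl) {f : Face} (hf : f ∈ Dl)
    (h : (∑ P ∈ (clsLoop (triSet (Dl.map (Face.shiftBy (-w))).toFinset) ((Face.shiftBy (-w) f).hv .W)).filter
            (fun P => loopWnd ((Face.shiftBy (-w) f).hv .W) P ≠ 0),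
          edir ((Face.shiftBy (-w) f).hv .W) (finalDart P).1 * pwt P) +
        (∑ P ∈ (clsLoop (triSet (Dl.map (Face.shiftBy (-w))).toFinset) ((Face.shiftBy (-w) f).hv .E)).filter
            (fun P => loopWnd ((Face.shiftBy (-w) f).hv .E) P ≠ 0),
          edir ((Face.shiftBy (-w) f).hv .E) (finalDart P).1 * pwt P) ≠ 0) :
    {θ ∈ Set.Ioo 0 π |
        vertexFunctional (printedWeights θ) tFiveEighths (ybCoeff θ) Dl (w.side .W) f = 0}.Finite ∧
      {θ ∈ Set.Ioo 0 π |
          vertexFunctional (printedWeights θ) tFiveEighths (ybCoeff θ) Dl (w.side .W) f = 0}.ncard ≤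
        4 * maxExp Dl (w.side .W) f + 1 := by
  refine vertexFunctional_printed_zero_set_of_endpoint_ne_zero Dl (w.side .W) f (Or.inl fun h0 => h ?_)
  rw [← vertexFunctional_printed_pi_div_three_eq_sum_encircling Dl w hw hf, h0, mul_zero]

/-- ★ **THE `2π/3` TEST.** Same hole root, same `f ∈ Dl`: if the signed weight of the encircling honeycomb loop-class walks of
the REFLECTED triangle domain (reflection in the row of `w`) through the two triangles of `ρ_w f − w` is non-zero, then
the defect vanishes at at most `4K + 1` angles of `(0, π)`. The two tests are independent: they live on the two triangulations
of the rhombi of `Dl`. [cite: GlazmanManolescu2019, §1 (θ ↔ π − θ), Lemma 2.1] [cite: DuminilCopinSmirnov2012, Lemma 1] -/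
theorem vertexFunctional_printed_zero_set_of_sum_encircling_reflected_ne_zero (Dl : List Face) (w : Face)
    (hw : ((w.1 - 1 : ℤ), w.2) ∉ Dl) {f : Face} (hf : f ∈ Dl)
    (h : (∑ P ∈ (clsLoop (triSet ((Dl.map (mirrorRowFace w.2)).map (Face.shiftBy (-w))).toFinset)
              ((Face.shiftBy (-w) (mirrorRowFace w.2 f)).hv .W)).filter
            (fun P => loopWnd ((Face.shiftBy (-w) (mirrorRowFace w.2 f)).hv .W) P ≠ 0),
          edir ((Face.shiftBy (-w) (mirrorRowFace w.2 f)).hv .W) (finalDart P).1 * pwt P) +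
        (∑ P ∈ (clsLoop (triSet ((Dl.map (mirrorRowFace w.2)).map (Face.shiftBy (-w))).toFinset)
              ((Face.shiftBy (-w) (mirrorRowFace w.2 f)).hv .E)).filter
            (fun P => loopWnd ((Face.shiftBy (-w) (mirrorRowFace w.2 f)).hv .E) P ≠ 0),
          edir ((Face.shiftBy (-w) (mirrorRowFace w.2 f)).hv .E) (finalDart P).1 * pwt P) ≠ 0) :
    {θ ∈ Set.Ioo 0 π |
        vertexFunctional (printedWeights θ) tFiveEighths (ybCoeff θ) Dl (w.side .W) f = 0}.Finite ∧
      {θ ∈ Set.Ioo 0 π |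
          vertexFunctional (printedWeights θ) tFiveEighths (ybCoeff θ) Dl (w.side .W) f = 0}.ncard ≤
        4 * maxExp Dl (w.side .W) f + 1 := by
  refine vertexFunctional_printed_zero_set_of_endpoint_ne_zero Dl (w.side .W) f (Or.inr fun h0 => h ?_)
  have e := vertexFunctional_printed_two_pi_div_three_eq_neg_conj_sum_encircling Dl w hw hf
  rw [h0, mul_zero] at e
  have e' := congrArg (starRingEnd ℂ) e
  rw [map_zero, map_neg, Complex.conj_conj] at e'
  linear_combination e'

/-- **Conversely, an identically vanishing defect kills BOTH honeycomb sums**: if `VF_{Dl}(w.side W; f; θ) = 0` for every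
`θ ∈ (0, π)`, then the encircling sum of the triangle domain of `Dl − w` at the two triangles of `f − w` AND the encircling sum
of the reflected triangle domain at the two triangles of `ρ_w f − w` both vanish.
[cite: GlazmanManolescu2019, §1 (θ = π/3 and θ ↔ π − θ), Lemma 2.1] [cite: DuminilCopinSmirnov2012, Lemma 1] -/
theorem sum_encircling_eq_zero_and_reflected_of_forall_eq_zero (Dl : List Face) (w : Face)
    (hw : ((w.1 - 1 : ℤ), w.2) ∉ Dl) {f : Face} (hf : f ∈ Dl)
    (h : ∀ θ ∈ Set.Ioo 0 π, vertexFunctional (printedWeights θ) tFiveEighths (ybCoeff θ) Dl (w.side .W) f = 0) :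
    (∑ P ∈ (clsLoop (triSet (Dl.map (Face.shiftBy (-w))).toFinset) ((Face.shiftBy (-w) f).hv .W)).filter
            (fun P => loopWnd ((Face.shiftBy (-w) f).hv .W) P ≠ 0),
          edir ((Face.shiftBy (-w) f).hv .W) (finalDart P).1 * pwt P) +
        (∑ P ∈ (clsLoop (triSet (Dl.map (Face.shiftBy (-w))).toFinset) ((Face.shiftBy (-w) f).hv .E)).filter
            (fun P => loopWnd ((Face.shiftBy (-w) f).hv .E) P ≠ 0),
          edir ((Face.shiftBy (-w) f).hv .E) (finalDart P).1 * pwt P) = 0 ∧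
      (∑ P ∈ (clsLoop (triSet ((Dl.map (mirrorRowFace w.2)).map (Face.shiftBy (-w))).toFinset)
              ((Face.shiftBy (-w) (mirrorRowFace w.2 f)).hv .W)).filter
            (fun P => loopWnd ((Face.shiftBy (-w) (mirrorRowFace w.2 f)).hv .W) P ≠ 0),
          edir ((Face.shiftBy (-w) (mirrorRowFace w.2 f)).hv .W) (finalDart P).1 * pwt P) +
        (∑ P ∈ (clsLoop (triSet ((Dl.map (mirrorRowFace w.2)).map (Face.shiftBy (-w))).toFinset)
              ((Face.shiftBy (-w) (mirrorRowFace w.2 f)).hv .E)).filter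
            (fun P => loopWnd ((Face.shiftBy (-w) (mirrorRowFace w.2 f)).hv .E) P ≠ 0),
          edir ((Face.shiftBy (-w) (mirrorRowFace w.2 f)).hv .E) (finalDart P).1 * pwt P) = 0 := by
  constructor
  · rw [← vertexFunctional_printed_pi_div_three_eq_sum_encircling Dl w hw hf, h _ pi_div_three_mem_Ioo, mul_zero]
  · have e := vertexFunctional_printed_two_pi_div_three_eq_neg_conj_sum_encircling Dl w hw hf
    rw [h _ two_pi_div_three_mem_Ioo, mul_zero] at e
    have e' := congrArg (starRingEnd ℂ) e
    rw [map_zero, map_neg, Complex.conj_conj] at e'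
    linear_combination e'

end Tests


/-! ## §6. A hole symmetric in the row of its root rhombus: the two hexagonal angles are mirror images of each other -/

section Symmetric

/-- A face list symmetric under the reflection in the row axis `c` has the same face DOMAIN as its reflection (as sets;
the lists differ by a permutation). [cite: GlazmanManolescu2019, §2.1 (finite domains of faces)] -/
theorem dom_map_mirrorRowFace_of_symmetric (c : ℤ) {Dl : List Face} (hsym : ∀ f ∈ Dl, mirrorRowFace c f ∈ Dl) :
    PlaquetteWalk.dom (Dl.map (mirrorRowFace c)) = PlaquetteWalk.dom Dl := by
  ext f
  rw [mem_dom_map_mirrorRowFace]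
  constructor
  · intro h
    have h' := hsym _ h
    rwa [mirrorRowFace_mirrorRowFace] at h'
  · intro h
    exact hsym _ h

/-- On a symmetric face list the vertex functional of the reflected LIST equals that of the list (it depends on the list
only through its domain: `VF` is a phase times a combination of values of `parafermionOn (dom ·)`).
[cite: GlazmanManolescu2019, §2.1, Lemma 2.1 eq. (CR)] -/
theorem vertexFunctional_printed_map_mirrorRowFace_of_symmetric (θ : ℝ) (c : ℤ) {Dl : List Face}
    (hsym : ∀ f ∈ Dl, mirrorRowFace c f ∈ Dl) (a : MidEdge) (f : Face) :
    vertexFunctional (printedWeights θ) tFiveEighths (ybCoeff θ) (Dl.map (mirrorRowFace c)) a f =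
      vertexFunctional (printedWeights θ) tFiveEighths (ybCoeff θ) Dl a f := by
  rw [vertexFunctional_printed_eq_phase_mul_lem21Defect, vertexFunctional_printed_eq_phase_mul_lem21Defect]
  simp only [parafermionOn_congr (dom_map_mirrorRowFace_of_symmetric c hsym)]

/-- ★ **A HOLE SYMMETRIC IN THE ROW OF ITS ROOT RHOMBUS: `VF_{2π/3}(f) = conj VF_{π/3}(ρ_w f)`** — the defect table at the
second hexagonal angle is the mirror image of the table at the first, so the two hexagonal tests of §5 coincide up to
`f ↦ ρ_w f` (and differ in general: the lane's asymmetric «keyhole» has a `π/3`-only zero and a `2π/3`-only zero at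
non-mirror cells). [cite: GlazmanManolescu2019, Lemma 2.1, eq. (2.2) (CR); §1 (θ ↔ π − θ)] -/
theorem vertexFunctional_printed_two_pi_div_three_eq_conj_pi_div_three_of_symmetric (Dl : List Face) (w : Face)
    (hsym : ∀ f ∈ Dl, mirrorRowFace w.2 f ∈ Dl) (f : Face) :
    vertexFunctional (printedWeights (2 * π / 3)) tFiveEighths (ybCoeff (2 * π / 3)) Dl (w.side .W) f =
      (starRingEnd ℂ) (vertexFunctional (printedWeights (π / 3)) tFiveEighths (ybCoeff (π / 3)) Dl (w.side .W)
        (mirrorRowFace w.2 f)) := by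
  rw [vertexFunctional_printed_two_pi_div_three_eq_conj_mirror_self_row,
    vertexFunctional_printed_map_mirrorRowFace_of_symmetric _ _ hsym]

/-- The zero sets at the two hexagonal angles of a symmetric hole are mirror images: `VF_{2π/3}(f) = 0 ⟺ VF_{π/3}(ρ_w f) = 0`.
[cite: GlazmanManolescu2019, Lemma 2.1, eq. (2.2) (CR); §1 (θ ↔ π − θ)] -/
theorem vertexFunctional_printed_two_pi_div_three_eq_zero_iff_of_symmetric (Dl : List Face) (w : Face)
    (hsym : ∀ f ∈ Dl, mirrorRowFace w.2 f ∈ Dl) (f : Face) :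
    vertexFunctional (printedWeights (2 * π / 3)) tFiveEighths (ybCoeff (2 * π / 3)) Dl (w.side .W) f = 0 ↔
      vertexFunctional (printedWeights (π / 3)) tFiveEighths (ybCoeff (π / 3)) Dl (w.side .W) (mirrorRowFace w.2 f) = 0 := by
  rw [vertexFunctional_printed_two_pi_div_three_eq_conj_pi_div_three_of_symmetric Dl w hsym, map_eq_zero]

end Symmetric


/-! ## §7. From honeycomb loops to plaquette odd crossings: the hexagonal tests feed the NECESSARY half of the lane's
encircling criterion (`YangBaxterSAWExcursionJordan`, the even–odd rule) -/

section OddCrossing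

open HV

/-- A `W`-root whose western neighbour is outside the list is not an interior mid-edge. [cite: GlazmanManolescu2019, §2.1 (the root mid-edge lies on the boundary of the domain)] -/
theorem faces_side_W_not_interior {Dl : List Face} {w : Face} (hw : ((w.1 - 1 : ℤ), w.2) ∉ Dl) :
    ¬((w.side .W).faces.1 ∈ PlaquetteWalk.dom Dl ∧ (w.side .W).faces.2 ∈ PlaquetteWalk.dom Dl) := by
  rintro ⟨h1, -⟩
  obtain ⟨k, j⟩ := w
  exact hw h1

/-- ★★ **A NON-ZERO SIGNED COUNT OF ENCIRCLING HONEYCOMB LOOPS FORCES AN ODD-CROSSING PLAQUETTE EXCURSION.** For a `W`-rooted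
hole root (western neighbour of `w` outside `Dl`) and `f ∈ Dl`: if the signed weight of Duminil-Copin–Smirnov's loop-class
walks through the two triangles of `f − w` that wind about the root face is non-zero, then some Glazman–Manolescu walk of
class `B2a` at `f` has an excursion polygon crossing the lattice half-line behind the root an ODD number of times — the
honeycomb winding number and the plaquette crossing parity, two combinatorial notions of «the walk surrounds the hole», linked
through the analytic identity at `θ = π/3` (dictionary §15) and the tree's necessary half of the encircling criterion
(`exists_odd_rayCountAt_of_vertexFunctional_printed_ne_zero`, the even–odd rule).
[cite: GlazmanManolescu2019, Lemma 2.1, eq. (2.2) (CR); §1 (θ = π/3)] [cite: DuminilCopinSmirnov2012, Lemma 1]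
[cite: CourantRobbins1958, Ch. V Appendix §2 (The Jordan Curve Theorem for Polygons: the even–odd rule)] -/
theorem exists_odd_rayCountAt_of_sum_encircling_ne_zero (Dl : List Face) (w : Face)
    (hw : ((w.1 - 1 : ℤ), w.2) ∉ Dl) {f : Face} (hf : f ∈ Dl)
    (h : (∑ P ∈ (clsLoop (triSet (Dl.map (Face.shiftBy (-w))).toFinset) ((Face.shiftBy (-w) f).hv .W)).filter
            (fun P => loopWnd ((Face.shiftBy (-w) f).hv .W) P ≠ 0),
          edir ((Face.shiftBy (-w) f).hv .W) (finalDart P).1 * pwt P) +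
        (∑ P ∈ (clsLoop (triSet (Dl.map (Face.shiftBy (-w))).toFinset) ((Face.shiftBy (-w) f).hv .E)).filter
            (fun P => loopWnd ((Face.shiftBy (-w) f).hv .E) P ≠ 0),
          edir ((Face.shiftBy (-w) f).hv .E) (finalDart P).1 * pwt P) ≠ 0) :
    ∃ (hr : RootedFace (PlaquetteWalk.dom Dl) (w.side .W) f) (ω : ΩG (PlaquetteWalk.dom Dl) (w.side .W) f)
      (hB : ω.IsB2a), Odd (ω.rayCountAt hr hB w .W) := by
  refine exists_odd_rayCountAt_of_vertexFunctional_printed_ne_zero (θ := π / 3)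
    ⟨le_rfl, by linarith [Real.pi_pos]⟩ Dl rfl (faces_side_W_not_interior hw) f hf (fun h0 => h ?_)
  rw [← vertexFunctional_printed_pi_div_three_eq_sum_encircling Dl w hw hf, h0, mul_zero]

/-- ★★ **The same from the OTHER triangulation**: a non-zero signed weight of the encircling loop-class walks of the REFLECTED
triangle domain (reflection in the row of `w`) through the two triangles of `ρ_w f − w` forces an odd-crossing class-`B2a`
excursion at `f` (through the identity at `θ = 2π/3`, §3). [cite: GlazmanManolescu2019, Lemma 2.1, eq. (2.2) (CR); §1 (θ ↔ π − θ)]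
[cite: DuminilCopinSmirnov2012, Lemma 1] [cite: CourantRobbins1958, Ch. V Appendix §2 (the even–odd rule)] -/
theorem exists_odd_rayCountAt_of_sum_encircling_reflected_ne_zero (Dl : List Face) (w : Face)
    (hw : ((w.1 - 1 : ℤ), w.2) ∉ Dl) {f : Face} (hf : f ∈ Dl)
    (h : (∑ P ∈ (clsLoop (triSet ((Dl.map (mirrorRowFace w.2)).map (Face.shiftBy (-w))).toFinset)
              ((Face.shiftBy (-w) (mirrorRowFace w.2 f)).hv .W)).filter
            (fun P => loopWnd ((Face.shiftBy (-w) (mirrorRowFace w.2 f)).hv .W) P ≠ 0),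
          edir ((Face.shiftBy (-w) (mirrorRowFace w.2 f)).hv .W) (finalDart P).1 * pwt P) +
        (∑ P ∈ (clsLoop (triSet ((Dl.map (mirrorRowFace w.2)).map (Face.shiftBy (-w))).toFinset)
              ((Face.shiftBy (-w) (mirrorRowFace w.2 f)).hv .E)).filter
            (fun P => loopWnd ((Face.shiftBy (-w) (mirrorRowFace w.2 f)).hv .E) P ≠ 0),
          edir ((Face.shiftBy (-w) (mirrorRowFace w.2 f)).hv .E) (finalDart P).1 * pwt P) ≠ 0) :
    ∃ (hr : RootedFace (PlaquetteWalk.dom Dl) (w.side .W) f) (ω : ΩG (PlaquetteWalk.dom Dl) (w.side .W) f)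
      (hB : ω.IsB2a), Odd (ω.rayCountAt hr hB w .W) := by
  refine exists_odd_rayCountAt_of_vertexFunctional_printed_ne_zero (θ := 2 * π / 3)
    ⟨by linarith [Real.pi_pos], le_rfl⟩ Dl rfl (faces_side_W_not_interior hw) f hf (fun h0 => h ?_)
  have e := vertexFunctional_printed_two_pi_div_three_eq_neg_conj_sum_encircling Dl w hw hf
  rw [h0, mul_zero] at e
  have e' := congrArg (starRingEnd ℂ) e
  rw [map_zero, map_neg, Complex.conj_conj] at e'
  linear_combination e'

end OddCrossing


/-! ## §8. The hole-root defect at `E`-, `S`- and `N`-rooted rhombi at `θ = π/3` as encircling honeycomb sums (the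
dictionary's §16 composed with `HexSAWVertexRelationHoleRoot.sum_cv_eq_sum_encircling`), their odd-crossing transfers, and
the second angle at every root orientation -/

section AllRoots

open HV

/-- The western neighbour of the re-rooted origin is outside the HALF-TURNED, translated list of an `E`-rooted hole.
[cite: GlazmanManolescu2019, §1 (the lattice of rhombi), §4.2 (translation invariance)] -/
theorem neg_one_zero_not_mem_halfTurn_shift {Dl : List Face} {w : Face} (hw : ((w.1 + 1 : ℤ), w.2) ∉ Dl) :
    ((-1 : ℤ), (0 : ℤ)) ∉ (((Dl.map (mirrorColFace 0)).map (mirrorRowFace 0)).map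
      (Face.shiftBy (-(((-w.1 : ℤ), (-w.2 : ℤ)) : Face)))).toFinset := by
  rw [List.mem_toFinset, List.map_map, List.map_map, List.mem_map]
  rintro ⟨g, hg, he⟩
  obtain ⟨k, j⟩ := g
  simp only [Function.comp_apply, mirrorColFace, mirrorRowFace, Face.shiftBy, Prod.neg_mk, Prod.mk.injEq] at he
  obtain ⟨h1, h2⟩ := he
  have hk : k = w.1 + 1 := by omega
  have hj : j = w.2 := by omega
  subst hk; subst hj
  exact hw hg

/-- The image rhombus lies in the half-turned, translated list. [cite: GlazmanManolescu2019, §1 (the lattice of rhombi), §4.2] -/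
theorem mem_halfTurn_shift {Dl : List Face} {w f : Face} (hf : f ∈ Dl) :
    Face.shiftBy (-(((-w.1 : ℤ), (-w.2 : ℤ)) : Face)) (mirrorRowFace 0 (mirrorColFace 0 f)) ∈
      (((Dl.map (mirrorColFace 0)).map (mirrorRowFace 0)).map (Face.shiftBy (-(((-w.1 : ℤ), (-w.2 : ℤ)) : Face)))).toFinset := by
  rw [List.mem_toFinset, List.map_map, List.map_map, List.mem_map]
  exact ⟨f, hf, rfl⟩

/-- ★★ **THE YANG–BAXTER DEFECT AT `θ = π/3` FROM AN `E`-ROOT = MINUS THE ENCIRCLING HONEYCOMB LOOPS OF THE HALF-TURNED TRIANGLE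
DOMAIN** (root on the `E` side of `w`, eastern neighbour outside; `V_E` = triangle domain of `−Dl` translated by `w`, `T₁, T₂` the
two triangles of the image rhombus of `f ∈ Dl`): `(2ω − 1)·VF_{π/3}(Dl; w.side E; f) = −[Σ_{encircling at T₁} dir·x_c^ℓ λ^{pturn} +
Σ_{encircling at T₂} …]` (dictionary §16 ∘ DCS's hole-root vertex relation). [cite: GlazmanManolescu2019, §1 (θ = π/3), Lemma 2.1]
[cite: DuminilCopinSmirnov2012, Lemma 1 and its proof] -/
theorem vertexFunctional_printed_pi_div_three_eq_neg_sum_encircling_of_E_root (Dl : List Face) (w : Face)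
    (hw : ((w.1 + 1 : ℤ), w.2) ∉ Dl) {f : Face} (hf : f ∈ Dl) :
    (2 * omg - 1) * vertexFunctional (printedWeights (π / 3)) tFiveEighths (ybCoeff (π / 3)) Dl (w.side .E) f =
      -((∑ P ∈ (clsLoop (triSet (((Dl.map (mirrorColFace 0)).map (mirrorRowFace 0)).map
              (Face.shiftBy (-(((-w.1 : ℤ), (-w.2 : ℤ)) : Face)))).toFinset)
              ((Face.shiftBy (-(((-w.1 : ℤ), (-w.2 : ℤ)) : Face)) (mirrorRowFace 0 (mirrorColFace 0 f))).hv .W)).filter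
            (fun P => loopWnd ((Face.shiftBy (-(((-w.1 : ℤ), (-w.2 : ℤ)) : Face))
              (mirrorRowFace 0 (mirrorColFace 0 f))).hv .W) P ≠ 0),
          edir ((Face.shiftBy (-(((-w.1 : ℤ), (-w.2 : ℤ)) : Face)) (mirrorRowFace 0 (mirrorColFace 0 f))).hv .W)
            (finalDart P).1 * pwt P) +
        (∑ P ∈ (clsLoop (triSet (((Dl.map (mirrorColFace 0)).map (mirrorRowFace 0)).map
              (Face.shiftBy (-(((-w.1 : ℤ), (-w.2 : ℤ)) : Face)))).toFinset)
              ((Face.shiftBy (-(((-w.1 : ℤ), (-w.2 : ℤ)) : Face)) (mirrorRowFace 0 (mirrorColFace 0 f))).hv .E)).filter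
            (fun P => loopWnd ((Face.shiftBy (-(((-w.1 : ℤ), (-w.2 : ℤ)) : Face))
              (mirrorRowFace 0 (mirrorColFace 0 f))).hv .E) P ≠ 0),
          edir ((Face.shiftBy (-(((-w.1 : ℤ), (-w.2 : ℤ)) : Face)) (mirrorRowFace 0 (mirrorColFace 0 f))).hv .E)
            (finalDart P).1 * pwt P)) := by
  have hwOut := wOut_not_mem_triSet (neg_one_zero_not_mem_halfTurn_shift hw)
  have hfm := mem_halfTurn_shift (w := w) hf
  rw [vertexFunctional_printed_pi_div_three_eq_neg_sum_cv_of_E_root Dl w hw f, Finset.sum_add_distrib,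
    sum_cv_eq_sum_encircling hwOut (hv_mem_triSet hfm .W), sum_cv_eq_sum_encircling hwOut (hv_mem_triSet hfm .E)]

/-- The western neighbour of the re-rooted origin is outside the TRANSPOSED, translated list of an `S`-rooted hole.
[cite: GlazmanManolescu2019, §1 (the lattice of rhombi), §4.2 (translation invariance)] -/
theorem neg_one_zero_not_mem_transpose_shift {Dl : List Face} {w : Face} (hw : (w.1, (w.2 - 1 : ℤ)) ∉ Dl) :
    ((-1 : ℤ), (0 : ℤ)) ∉ ((Dl.map mirrorDiagFace).map (Face.shiftBy (-((w.2, w.1) : Face)))).toFinset := by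
  rw [List.mem_toFinset, List.map_map, List.mem_map]
  rintro ⟨g, hg, he⟩
  obtain ⟨k, j⟩ := g
  simp only [Function.comp_apply, mirrorDiagFace, Face.shiftBy, Prod.neg_mk, Prod.mk.injEq] at he
  obtain ⟨h1, h2⟩ := he
  have hk : k = w.1 := by omega
  have hj : j = w.2 - 1 := by omega
  subst hk; subst hj
  exact hw hg

/-- The image rhombus lies in the transposed, translated list. [cite: GlazmanManolescu2019, §1 (the lattice of rhombi), §4.2] -/
theorem mem_transpose_shift {Dl : List Face} {w f : Face} (hf : f ∈ Dl) :
    (Face.shiftBy (-((w.2, w.1) : Face)) (mirrorDiagFace f)) ∈ ((Dl.map mirrorDiagFace).map (Face.shiftBy (-((w.2, w.1) : Face)))).toFinset := by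
  rw [List.mem_toFinset, List.map_map, List.mem_map]
  exact ⟨f, hf, rfl⟩

/-- ★★ **THE YANG–BAXTER DEFECT AT `θ = π/3` FROM AN `S`-ROOT = `−r(π/3)·conj` OF THE ENCIRCLING HONEYCOMB LOOPS OF THE TRANSPOSED
TRIANGLE DOMAIN** (root on the `S` side of `w`, southern neighbour outside; `V_S` = triangle domain of `τDl` translated by `−τw`,
`T₁, T₂` the two triangles of the image rhombus of `f ∈ Dl`). [cite: GlazmanManolescu2019, §1 (θ = π/3), Lemma 2.1, eq. (2.2) (CR)]
[cite: DuminilCopinSmirnov2012, Lemma 1 and its proof] -/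
theorem vertexFunctional_printed_pi_div_three_eq_neg_conj_sum_encircling_of_S_root (Dl : List Face) (w : Face)
    (hw : (w.1, (w.2 - 1 : ℤ)) ∉ Dl) {f : Face} (hf : f ∈ Dl) :
    (2 * omg - 1) * vertexFunctional (printedWeights (π / 3)) tFiveEighths (ybCoeff (π / 3)) Dl (w.side .S) f =
      -(ybRatio (π / 3) * (starRingEnd ℂ)
        ((∑ P ∈ (clsLoop (triSet ((Dl.map mirrorDiagFace).map (Face.shiftBy (-((w.2, w.1) : Face)))).toFinset) ((Face.shiftBy (-((w.2, w.1) : Face)) (mirrorDiagFace f)).hv .W)).filter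
            (fun P => loopWnd ((Face.shiftBy (-((w.2, w.1) : Face)) (mirrorDiagFace f)).hv .W) P ≠ 0),
          edir ((Face.shiftBy (-((w.2, w.1) : Face)) (mirrorDiagFace f)).hv .W) (finalDart P).1 * pwt P) +
        (∑ P ∈ (clsLoop (triSet ((Dl.map mirrorDiagFace).map (Face.shiftBy (-((w.2, w.1) : Face)))).toFinset) ((Face.shiftBy (-((w.2, w.1) : Face)) (mirrorDiagFace f)).hv .E)).filter
            (fun P => loopWnd ((Face.shiftBy (-((w.2, w.1) : Face)) (mirrorDiagFace f)).hv .E) P ≠ 0),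
          edir ((Face.shiftBy (-((w.2, w.1) : Face)) (mirrorDiagFace f)).hv .E) (finalDart P).1 * pwt P))) := by
  have hwOut := wOut_not_mem_triSet (neg_one_zero_not_mem_transpose_shift hw)
  have hfm := mem_transpose_shift (w := w) hf
  rw [vertexFunctional_printed_pi_div_three_eq_conj_sum_cv_of_S_root Dl w hw f, Finset.sum_add_distrib,
    sum_cv_eq_sum_encircling hwOut (hv_mem_triSet hfm .W), sum_cv_eq_sum_encircling hwOut (hv_mem_triSet hfm .E)]

/-- The western neighbour of the re-rooted origin is outside the ANTI-TRANSPOSED, translated list of an `N`-rooted hole.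
[cite: GlazmanManolescu2019, §1 (the lattice of rhombi), §4.2 (translation invariance)] -/
theorem neg_one_zero_not_mem_antiTranspose_shift {Dl : List Face} {w : Face} (hw : (w.1, (w.2 + 1 : ℤ)) ∉ Dl) :
    ((-1 : ℤ), (0 : ℤ)) ∉ ((((Dl.map (mirrorColFace 0)).map (mirrorRowFace 0)).map mirrorDiagFace).map (Face.shiftBy (-(((-w.2 : ℤ), (-w.1 : ℤ)) : Face)))).toFinset := by
  rw [List.mem_toFinset, List.map_map, List.map_map, List.map_map, List.mem_map]
  rintro ⟨g, hg, he⟩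
  obtain ⟨k, j⟩ := g
  simp only [Function.comp_apply, mirrorColFace, mirrorRowFace, mirrorDiagFace, Face.shiftBy, Prod.neg_mk,
    Prod.mk.injEq] at he
  obtain ⟨h1, h2⟩ := he
  have hk : k = w.1 := by omega
  have hj : j = w.2 + 1 := by omega
  subst hk; subst hj
  exact hw hg

/-- The image rhombus lies in the anti-transposed, translated list. [cite: GlazmanManolescu2019, §1 (the lattice of rhombi), §4.2] -/
theorem mem_antiTranspose_shift {Dl : List Face} {w f : Face} (hf : f ∈ Dl) :
    (Face.shiftBy (-(((-w.2 : ℤ), (-w.1 : ℤ)) : Face)) (mirrorDiagFace (mirrorRowFace 0 (mirrorColFace 0 f)))) ∈ ((((Dl.map (mirrorColFace 0)).map (mirrorRowFace 0)).map mirrorDiagFace).map (Face.shiftBy (-(((-w.2 : ℤ), (-w.1 : ℤ)) : Face)))).toFinset := by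
  rw [List.mem_toFinset, List.map_map, List.map_map, List.map_map, List.mem_map]
  exact ⟨f, hf, rfl⟩

/-- ★★ **THE YANG–BAXTER DEFECT AT `θ = π/3` FROM AN `N`-ROOT = `+r(π/3)·conj` OF THE ENCIRCLING HONEYCOMB LOOPS OF THE ANTI-TRANSPOSED
TRIANGLE DOMAIN** (root on the `N` side of `w`, northern neighbour outside; `σ(x, y) = (−y, −x)`, `V_N` = triangle domain of `σDl`
translated by `−σw`). [cite: GlazmanManolescu2019, §1 (θ = π/3), Lemma 2.1, eq. (2.2) (CR)] [cite: DuminilCopinSmirnov2012, Lemma 1 and its proof] -/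
theorem vertexFunctional_printed_pi_div_three_eq_conj_sum_encircling_of_N_root (Dl : List Face) (w : Face)
    (hw : (w.1, (w.2 + 1 : ℤ)) ∉ Dl) {f : Face} (hf : f ∈ Dl) :
    (2 * omg - 1) * vertexFunctional (printedWeights (π / 3)) tFiveEighths (ybCoeff (π / 3)) Dl (w.side .N) f =
      ybRatio (π / 3) * (starRingEnd ℂ)
        ((∑ P ∈ (clsLoop (triSet ((((Dl.map (mirrorColFace 0)).map (mirrorRowFace 0)).map mirrorDiagFace).map (Face.shiftBy (-(((-w.2 : ℤ), (-w.1 : ℤ)) : Face)))).toFinset) ((Face.shiftBy (-(((-w.2 : ℤ), (-w.1 : ℤ)) : Face)) (mirrorDiagFace (mirrorRowFace 0 (mirrorColFace 0 f)))).hv .W)).filter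
            (fun P => loopWnd ((Face.shiftBy (-(((-w.2 : ℤ), (-w.1 : ℤ)) : Face)) (mirrorDiagFace (mirrorRowFace 0 (mirrorColFace 0 f)))).hv .W) P ≠ 0),
          edir ((Face.shiftBy (-(((-w.2 : ℤ), (-w.1 : ℤ)) : Face)) (mirrorDiagFace (mirrorRowFace 0 (mirrorColFace 0 f)))).hv .W) (finalDart P).1 * pwt P) +
        (∑ P ∈ (clsLoop (triSet ((((Dl.map (mirrorColFace 0)).map (mirrorRowFace 0)).map mirrorDiagFace).map (Face.shiftBy (-(((-w.2 : ℤ), (-w.1 : ℤ)) : Face)))).toFinset) ((Face.shiftBy (-(((-w.2 : ℤ), (-w.1 : ℤ)) : Face)) (mirrorDiagFace (mirrorRowFace 0 (mirrorColFace 0 f)))).hv .E)).filter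
            (fun P => loopWnd ((Face.shiftBy (-(((-w.2 : ℤ), (-w.1 : ℤ)) : Face)) (mirrorDiagFace (mirrorRowFace 0 (mirrorColFace 0 f)))).hv .E) P ≠ 0),
          edir ((Face.shiftBy (-(((-w.2 : ℤ), (-w.1 : ℤ)) : Face)) (mirrorDiagFace (mirrorRowFace 0 (mirrorColFace 0 f)))).hv .E) (finalDart P).1 * pwt P)) := by
  have hwOut := wOut_not_mem_triSet (neg_one_zero_not_mem_antiTranspose_shift hw)
  have hfm := mem_antiTranspose_shift (w := w) hf
  rw [vertexFunctional_printed_pi_div_three_eq_conj_sum_cv_of_N_root Dl w hw f, Finset.sum_add_distrib,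
    sum_cv_eq_sum_encircling hwOut (hv_mem_triSet hfm .W), sum_cv_eq_sum_encircling hwOut (hv_mem_triSet hfm .E)]

/-- An `E`-root whose eastern neighbour is outside the list is not an interior mid-edge. [cite: GlazmanManolescu2019, §2.1 (the root lies on the boundary)] -/
theorem faces_side_E_not_interior {Dl : List Face} {w : Face} (hw : ((w.1 + 1 : ℤ), w.2) ∉ Dl) :
    ¬((w.side .E).faces.1 ∈ PlaquetteWalk.dom Dl ∧ (w.side .E).faces.2 ∈ PlaquetteWalk.dom Dl) := by
  rintro ⟨-, h2⟩
  obtain ⟨k, j⟩ := w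
  exact hw h2

/-- An `S`-root whose southern neighbour is outside the list is not an interior mid-edge. [cite: GlazmanManolescu2019, §2.1 (the root lies on the boundary)] -/
theorem faces_side_S_not_interior {Dl : List Face} {w : Face} (hw : (w.1, (w.2 - 1 : ℤ)) ∉ Dl) :
    ¬((w.side .S).faces.1 ∈ PlaquetteWalk.dom Dl ∧ (w.side .S).faces.2 ∈ PlaquetteWalk.dom Dl) := by
  rintro ⟨h1, -⟩
  obtain ⟨k, j⟩ := w
  exact hw h1

/-- An `N`-root whose northern neighbour is outside the list is not an interior mid-edge. [cite: GlazmanManolescu2019, §2.1 (the root lies on the boundary)] -/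
theorem faces_side_N_not_interior {Dl : List Face} {w : Face} (hw : (w.1, (w.2 + 1 : ℤ)) ∉ Dl) :
    ¬((w.side .N).faces.1 ∈ PlaquetteWalk.dom Dl ∧ (w.side .N).faces.2 ∈ PlaquetteWalk.dom Dl) := by
  rintro ⟨-, h2⟩
  obtain ⟨k, j⟩ := w
  exact hw h2

/-- ★★ **Encircling honeycomb loops force an odd-crossing excursion — `E`-root**: a non-zero signed weight of the loop-class
walks of `V_E` through `T₁, T₂` that wind about the root face gives a class-`B2a` walk at `f` whose excursion crosses the half-line
behind the root (to the EAST of `w`) an odd number of times. [cite: GlazmanManolescu2019, Lemma 2.1, eq. (2.2) (CR); §1 (θ = π/3)]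
[cite: DuminilCopinSmirnov2012, Lemma 1] [cite: CourantRobbins1958, Ch. V Appendix §2 (the even–odd rule)] -/
theorem exists_odd_rayCountAt_of_sum_encircling_ne_zero_of_E_root (Dl : List Face) (w : Face)
    (hw : ((w.1 + 1 : ℤ), w.2) ∉ Dl) {f : Face} (hf : f ∈ Dl)
    (h : (∑ P ∈ (clsLoop (triSet (((Dl.map (mirrorColFace 0)).map (mirrorRowFace 0)).map (Face.shiftBy (-(((-w.1 : ℤ), (-w.2 : ℤ)) : Face)))).toFinset) ((Face.shiftBy (-(((-w.1 : ℤ), (-w.2 : ℤ)) : Face)) (mirrorRowFace 0 (mirrorColFace 0 f))).hv .W)).filter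
            (fun P => loopWnd ((Face.shiftBy (-(((-w.1 : ℤ), (-w.2 : ℤ)) : Face)) (mirrorRowFace 0 (mirrorColFace 0 f))).hv .W) P ≠ 0),
          edir ((Face.shiftBy (-(((-w.1 : ℤ), (-w.2 : ℤ)) : Face)) (mirrorRowFace 0 (mirrorColFace 0 f))).hv .W) (finalDart P).1 * pwt P) +
        (∑ P ∈ (clsLoop (triSet (((Dl.map (mirrorColFace 0)).map (mirrorRowFace 0)).map (Face.shiftBy (-(((-w.1 : ℤ), (-w.2 : ℤ)) : Face)))).toFinset) ((Face.shiftBy (-(((-w.1 : ℤ), (-w.2 : ℤ)) : Face)) (mirrorRowFace 0 (mirrorColFace 0 f))).hv .E)).filter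
            (fun P => loopWnd ((Face.shiftBy (-(((-w.1 : ℤ), (-w.2 : ℤ)) : Face)) (mirrorRowFace 0 (mirrorColFace 0 f))).hv .E) P ≠ 0),
          edir ((Face.shiftBy (-(((-w.1 : ℤ), (-w.2 : ℤ)) : Face)) (mirrorRowFace 0 (mirrorColFace 0 f))).hv .E) (finalDart P).1 * pwt P) ≠ 0) :
    ∃ (hr : RootedFace (PlaquetteWalk.dom Dl) (w.side .E) f) (ω : ΩG (PlaquetteWalk.dom Dl) (w.side .E) f)
      (hB : ω.IsB2a), Odd (ω.rayCountAt hr hB w .E) := by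
  refine exists_odd_rayCountAt_of_vertexFunctional_printed_ne_zero (θ := π / 3)
    ⟨le_rfl, by linarith [Real.pi_pos]⟩ Dl rfl (faces_side_E_not_interior hw) f hf (fun h0 => h ?_)
  have e := vertexFunctional_printed_pi_div_three_eq_neg_sum_encircling_of_E_root Dl w hw hf
  rw [h0, mul_zero] at e
  linear_combination e

/-- ★★ **Encircling honeycomb loops force an odd-crossing excursion — `S`-root** (half-line behind the root = below `w`).
[cite: GlazmanManolescu2019, Lemma 2.1, eq. (2.2) (CR); §1 (θ = π/3)] [cite: DuminilCopinSmirnov2012, Lemma 1]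
[cite: CourantRobbins1958, Ch. V Appendix §2 (the even–odd rule)] -/
theorem exists_odd_rayCountAt_of_sum_encircling_ne_zero_of_S_root (Dl : List Face) (w : Face)
    (hw : (w.1, (w.2 - 1 : ℤ)) ∉ Dl) {f : Face} (hf : f ∈ Dl)
    (h : (∑ P ∈ (clsLoop (triSet ((Dl.map mirrorDiagFace).map (Face.shiftBy (-((w.2, w.1) : Face)))).toFinset) ((Face.shiftBy (-((w.2, w.1) : Face)) (mirrorDiagFace f)).hv .W)).filter
            (fun P => loopWnd ((Face.shiftBy (-((w.2, w.1) : Face)) (mirrorDiagFace f)).hv .W) P ≠ 0),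
          edir ((Face.shiftBy (-((w.2, w.1) : Face)) (mirrorDiagFace f)).hv .W) (finalDart P).1 * pwt P) +
        (∑ P ∈ (clsLoop (triSet ((Dl.map mirrorDiagFace).map (Face.shiftBy (-((w.2, w.1) : Face)))).toFinset) ((Face.shiftBy (-((w.2, w.1) : Face)) (mirrorDiagFace f)).hv .E)).filter
            (fun P => loopWnd ((Face.shiftBy (-((w.2, w.1) : Face)) (mirrorDiagFace f)).hv .E) P ≠ 0),
          edir ((Face.shiftBy (-((w.2, w.1) : Face)) (mirrorDiagFace f)).hv .E) (finalDart P).1 * pwt P) ≠ 0) :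
    ∃ (hr : RootedFace (PlaquetteWalk.dom Dl) (w.side .S) f) (ω : ΩG (PlaquetteWalk.dom Dl) (w.side .S) f)
      (hB : ω.IsB2a), Odd (ω.rayCountAt hr hB w .S) := by
  refine exists_odd_rayCountAt_of_vertexFunctional_printed_ne_zero (θ := π / 3)
    ⟨le_rfl, by linarith [Real.pi_pos]⟩ Dl rfl (faces_side_S_not_interior hw) f hf (fun h0 => h ?_)
  have e := vertexFunctional_printed_pi_div_three_eq_neg_conj_sum_encircling_of_S_root Dl w hw hf
  rw [h0, mul_zero] at e
  have hr : ybRatio (π / 3) ≠ 0 := Complex.exp_ne_zero _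
  have e' : (starRingEnd ℂ) ((∑ P ∈ (clsLoop (triSet ((Dl.map mirrorDiagFace).map (Face.shiftBy (-((w.2, w.1) : Face)))).toFinset) ((Face.shiftBy (-((w.2, w.1) : Face)) (mirrorDiagFace f)).hv .W)).filter
            (fun P => loopWnd ((Face.shiftBy (-((w.2, w.1) : Face)) (mirrorDiagFace f)).hv .W) P ≠ 0),
          edir ((Face.shiftBy (-((w.2, w.1) : Face)) (mirrorDiagFace f)).hv .W) (finalDart P).1 * pwt P) +
        (∑ P ∈ (clsLoop (triSet ((Dl.map mirrorDiagFace).map (Face.shiftBy (-((w.2, w.1) : Face)))).toFinset) ((Face.shiftBy (-((w.2, w.1) : Face)) (mirrorDiagFace f)).hv .E)).filter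
            (fun P => loopWnd ((Face.shiftBy (-((w.2, w.1) : Face)) (mirrorDiagFace f)).hv .E) P ≠ 0),
          edir ((Face.shiftBy (-((w.2, w.1) : Face)) (mirrorDiagFace f)).hv .E) (finalDart P).1 * pwt P)) = 0 := by
    have := neg_eq_zero.1 e.symm
    exact (mul_eq_zero.1 this).resolve_left hr
  exact (map_eq_zero _).1 e'

/-- ★★ **Encircling honeycomb loops force an odd-crossing excursion — `N`-root** (half-line behind the root = above `w`).
[cite: GlazmanManolescu2019, Lemma 2.1, eq. (2.2) (CR); §1 (θ = π/3)] [cite: DuminilCopinSmirnov2012, Lemma 1]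
[cite: CourantRobbins1958, Ch. V Appendix §2 (the even–odd rule)] -/
theorem exists_odd_rayCountAt_of_sum_encircling_ne_zero_of_N_root (Dl : List Face) (w : Face)
    (hw : (w.1, (w.2 + 1 : ℤ)) ∉ Dl) {f : Face} (hf : f ∈ Dl)
    (h : (∑ P ∈ (clsLoop (triSet ((((Dl.map (mirrorColFace 0)).map (mirrorRowFace 0)).map mirrorDiagFace).map (Face.shiftBy (-(((-w.2 : ℤ), (-w.1 : ℤ)) : Face)))).toFinset) ((Face.shiftBy (-(((-w.2 : ℤ), (-w.1 : ℤ)) : Face)) (mirrorDiagFace (mirrorRowFace 0 (mirrorColFace 0 f)))).hv .W)).filter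
            (fun P => loopWnd ((Face.shiftBy (-(((-w.2 : ℤ), (-w.1 : ℤ)) : Face)) (mirrorDiagFace (mirrorRowFace 0 (mirrorColFace 0 f)))).hv .W) P ≠ 0),
          edir ((Face.shiftBy (-(((-w.2 : ℤ), (-w.1 : ℤ)) : Face)) (mirrorDiagFace (mirrorRowFace 0 (mirrorColFace 0 f)))).hv .W) (finalDart P).1 * pwt P) +
        (∑ P ∈ (clsLoop (triSet ((((Dl.map (mirrorColFace 0)).map (mirrorRowFace 0)).map mirrorDiagFace).map (Face.shiftBy (-(((-w.2 : ℤ), (-w.1 : ℤ)) : Face)))).toFinset) ((Face.shiftBy (-(((-w.2 : ℤ), (-w.1 : ℤ)) : Face)) (mirrorDiagFace (mirrorRowFace 0 (mirrorColFace 0 f)))).hv .E)).filter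
            (fun P => loopWnd ((Face.shiftBy (-(((-w.2 : ℤ), (-w.1 : ℤ)) : Face)) (mirrorDiagFace (mirrorRowFace 0 (mirrorColFace 0 f)))).hv .E) P ≠ 0),
          edir ((Face.shiftBy (-(((-w.2 : ℤ), (-w.1 : ℤ)) : Face)) (mirrorDiagFace (mirrorRowFace 0 (mirrorColFace 0 f)))).hv .E) (finalDart P).1 * pwt P) ≠ 0) :
    ∃ (hr : RootedFace (PlaquetteWalk.dom Dl) (w.side .N) f) (ω : ΩG (PlaquetteWalk.dom Dl) (w.side .N) f)
      (hB : ω.IsB2a), Odd (ω.rayCountAt hr hB w .N) := by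
  refine exists_odd_rayCountAt_of_vertexFunctional_printed_ne_zero (θ := π / 3)
    ⟨le_rfl, by linarith [Real.pi_pos]⟩ Dl rfl (faces_side_N_not_interior hw) f hf (fun h0 => h ?_)
  have e := vertexFunctional_printed_pi_div_three_eq_conj_sum_encircling_of_N_root Dl w hw hf
  rw [h0, mul_zero] at e
  have hr : ybRatio (π / 3) ≠ 0 := Complex.exp_ne_zero _
  have e' : (starRingEnd ℂ) ((∑ P ∈ (clsLoop (triSet ((((Dl.map (mirrorColFace 0)).map (mirrorRowFace 0)).map mirrorDiagFace).map (Face.shiftBy (-(((-w.2 : ℤ), (-w.1 : ℤ)) : Face)))).toFinset) ((Face.shiftBy (-(((-w.2 : ℤ), (-w.1 : ℤ)) : Face)) (mirrorDiagFace (mirrorRowFace 0 (mirrorColFace 0 f)))).hv .W)).filter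
            (fun P => loopWnd ((Face.shiftBy (-(((-w.2 : ℤ), (-w.1 : ℤ)) : Face)) (mirrorDiagFace (mirrorRowFace 0 (mirrorColFace 0 f)))).hv .W) P ≠ 0),
          edir ((Face.shiftBy (-(((-w.2 : ℤ), (-w.1 : ℤ)) : Face)) (mirrorDiagFace (mirrorRowFace 0 (mirrorColFace 0 f)))).hv .W) (finalDart P).1 * pwt P) +
        (∑ P ∈ (clsLoop (triSet ((((Dl.map (mirrorColFace 0)).map (mirrorRowFace 0)).map mirrorDiagFace).map (Face.shiftBy (-(((-w.2 : ℤ), (-w.1 : ℤ)) : Face)))).toFinset) ((Face.shiftBy (-(((-w.2 : ℤ), (-w.1 : ℤ)) : Face)) (mirrorDiagFace (mirrorRowFace 0 (mirrorColFace 0 f)))).hv .E)).filter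
            (fun P => loopWnd ((Face.shiftBy (-(((-w.2 : ℤ), (-w.1 : ℤ)) : Face)) (mirrorDiagFace (mirrorRowFace 0 (mirrorColFace 0 f)))).hv .E) P ≠ 0),
          edir ((Face.shiftBy (-(((-w.2 : ℤ), (-w.1 : ℤ)) : Face)) (mirrorDiagFace (mirrorRowFace 0 (mirrorColFace 0 f)))).hv .E) (finalDart P).1 * pwt P)) = 0 := (mul_eq_zero.1 e.symm).resolve_left hr
  exact (map_eq_zero _).1 e'

/-- The reflection in the row of `w` fixes the `E` side of `w`. [cite: GlazmanManolescu2019, §1, Fig. 4 (z_E)] -/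
theorem mirrorRow_side_E_self_row (w : Face) : mirrorRow w.2 (w.side .E) = w.side .E := by
  rw [mirrorRow_side, mirrorRowFace_self_row]
  rfl

/-- The reflection in the row of `w` exchanges the `S` and `N` sides of `w`. [cite: GlazmanManolescu2019, §1, Fig. 4 (z_S, z_N)] -/
theorem mirrorRow_side_S_self_row (w : Face) : mirrorRow w.2 (w.side .S) = w.side .N := by
  rw [mirrorRow_side, mirrorRowFace_self_row]
  rfl

/-- The reflection in the row of `w` exchanges the `N` and `S` sides of `w`. [cite: GlazmanManolescu2019, §1, Fig. 4 (z_S, z_N)] -/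
theorem mirrorRow_side_N_self_row (w : Face) : mirrorRow w.2 (w.side .N) = w.side .S := by
  rw [mirrorRow_side, mirrorRowFace_self_row]
  rfl

/-- ★ **THE SECOND ANGLE AT AN `E`-ROOT**: `VF_{2π/3}(Dl; w.side E; f) = conj VF_{π/3}(ρ_w Dl; w.side E; ρ_w f)` — the reflection in
the row of `w` fixes the `E`-root, and the `E`-rooted `π/3` forms above apply to `ρ_w Dl` (its eastern neighbour of `w` is outside
iff that of `Dl` is). [cite: GlazmanManolescu2019, Lemma 2.1, eq. (2.2) (CR); §1 (θ ↔ π − θ)] -/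
theorem vertexFunctional_printed_two_pi_div_three_of_E_root_eq_conj (Dl : List Face) (w : Face) (f : Face) :
    vertexFunctional (printedWeights (2 * π / 3)) tFiveEighths (ybCoeff (2 * π / 3)) Dl (w.side .E) f =
      (starRingEnd ℂ) (vertexFunctional (printedWeights (π / 3)) tFiveEighths (ybCoeff (π / 3))
        (Dl.map (mirrorRowFace w.2)) (w.side .E) (mirrorRowFace w.2 f)) := by
  rw [vertexFunctional_printed_two_pi_div_three_eq_conj_map_mirrorRow w.2, mirrorRow_side_E_self_row]

/-- ★ **THE SECOND ANGLE AT AN `S`-ROOT IS THE FIRST ANGLE AT AN `N`-ROOT OF THE REFLECTED LIST**: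
`VF_{2π/3}(Dl; w.side S; f) = conj VF_{π/3}(ρ_w Dl; w.side N; ρ_w f)` (the reflection in the row of `w` exchanges its `S` and `N`
sides; the southern neighbour of `w` is outside `Dl` iff the northern one is outside `ρ_w Dl`).
[cite: GlazmanManolescu2019, Lemma 2.1, eq. (2.2) (CR); §1 (θ ↔ π − θ)] -/
theorem vertexFunctional_printed_two_pi_div_three_of_S_root_eq_conj (Dl : List Face) (w : Face) (f : Face) :
    vertexFunctional (printedWeights (2 * π / 3)) tFiveEighths (ybCoeff (2 * π / 3)) Dl (w.side .S) f =
      (starRingEnd ℂ) (vertexFunctional (printedWeights (π / 3)) tFiveEighths (ybCoeff (π / 3))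
        (Dl.map (mirrorRowFace w.2)) (w.side .N) (mirrorRowFace w.2 f)) := by
  rw [vertexFunctional_printed_two_pi_div_three_eq_conj_map_mirrorRow w.2, mirrorRow_side_S_self_row]

/-- ★ **THE SECOND ANGLE AT AN `N`-ROOT IS THE FIRST ANGLE AT AN `S`-ROOT OF THE REFLECTED LIST**:
`VF_{2π/3}(Dl; w.side N; f) = conj VF_{π/3}(ρ_w Dl; w.side S; ρ_w f)`. [cite: GlazmanManolescu2019, Lemma 2.1, eq. (2.2) (CR); §1 (θ ↔ π − θ)] -/
theorem vertexFunctional_printed_two_pi_div_three_of_N_root_eq_conj (Dl : List Face) (w : Face) (f : Face) :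
    vertexFunctional (printedWeights (2 * π / 3)) tFiveEighths (ybCoeff (2 * π / 3)) Dl (w.side .N) f =
      (starRingEnd ℂ) (vertexFunctional (printedWeights (π / 3)) tFiveEighths (ybCoeff (π / 3))
        (Dl.map (mirrorRowFace w.2)) (w.side .S) (mirrorRowFace w.2 f)) := by
  rw [vertexFunctional_printed_two_pi_div_three_eq_conj_map_mirrorRow w.2, mirrorRow_side_N_self_row]

end AllRoots


/-! ## §9. The CONE CRITERION at the hexagonal angles: one-sided encircling contributions cannot cancel (edition 5) -/

section Cone

open HV

/-- **A one-sided cone does not sum to zero**: if every term of a non-empty finite sum of complex numbers has positive real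
part after rotation by a fixed `conj u`, the sum is non-zero. [folklore] [cite: DuminilCopinSmirnov2012, proof of Lemma 1 (the pair and triplet contributions are compared by their arguments)] -/
theorem sum_ne_zero_of_cone {ι : Type*} (s : Finset ι) (g : ι → ℂ) (u : ℂ)
    (hpos : ∀ i ∈ s, 0 < (star u * g i).re) (hne : s.Nonempty) : ∑ i ∈ s, g i ≠ 0 := by
  intro h0
  have h : 0 < (star u * ∑ i ∈ s, g i).re := by
    rw [Finset.mul_sum, Complex.re_sum]
    exact Finset.sum_pos hpos hne
  rw [h0, mul_zero, Complex.zero_re] at h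
  exact lt_irrefl _ h

/-- Two one-sided cones with a common direction do not cancel either: if all terms of two finite sums have non-negative real part
after rotation by `conj u`, strictly positive on each, and one of the two index sets is non-empty, the total is non-zero. [folklore]
[cite: DuminilCopinSmirnov2012, proof of Lemma 1] -/
theorem add_sum_ne_zero_of_cone {ι κ : Type*} (s : Finset ι) (t : Finset κ) (g : ι → ℂ) (g' : κ → ℂ) (u : ℂ)
    (hpos : ∀ i ∈ s, 0 < (star u * g i).re) (hpos' : ∀ j ∈ t, 0 < (star u * g' j).re) (hne : s.Nonempty ∨ t.Nonempty) :
    ∑ i ∈ s, g i + ∑ j ∈ t, g' j ≠ 0 := by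
  intro h0
  have h1 : 0 ≤ (star u * ∑ i ∈ s, g i).re := by
    rw [Finset.mul_sum, Complex.re_sum]; exact Finset.sum_nonneg fun i hi => (hpos i hi).le
  have h2 : 0 ≤ (star u * ∑ j ∈ t, g' j).re := by
    rw [Finset.mul_sum, Complex.re_sum]; exact Finset.sum_nonneg fun j hj => (hpos' j hj).le
  have h : 0 < (star u * (∑ i ∈ s, g i + ∑ j ∈ t, g' j)).re := by
    rw [mul_add, Complex.add_re]
    rcases hne with hne | hne
    · have : 0 < (star u * ∑ i ∈ s, g i).re := by
        rw [Finset.mul_sum, Complex.re_sum]; exact Finset.sum_pos hpos hne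
      linarith
    · have : 0 < (star u * ∑ j ∈ t, g' j).re := by
        rw [Finset.mul_sum, Complex.re_sum]; exact Finset.sum_pos hpos' hne
      linarith
  rw [h0, mul_zero, Complex.zero_re] at h
  exact lt_irrefl _ h

/-- ★★ **THE CONE CRITERION AT `θ = π/3`.** For a `W`-rooted hole root and `f ∈ Dl`: if the contributions
`dir·x_c^ℓ·λ^{pturn}` of the honeycomb loop-class walks through the two triangles of `f − w` that wind about the root face all lie in
one OPEN HALF-PLANE (positive real part after a common rotation `conj u`) and at least one such walk exists, then the Yang–Baxter defect
at `f` does NOT vanish at `θ = π/3` — no cancellation is possible inside a one-sided cone. This is the hexagonal-ENDPOINT companion,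
in honeycomb vocabulary, of the lane's universal cone law on the OPEN range `(π/3, 2π/3)`
(`PlaquetteWalkHoleRootUniversalDirections.vertexFunctional_printed_cell_ne_zero_of_cone`, stated over wound class-`B2a` walks).
(The venture lane's census finds the contributions quantised to the sixteen directions `7.5° + 22.5°ℤ` with at most eight per cell
and an arc `< 180°` at most cells.)
[cite: GlazmanManolescu2019, §1 (θ = π/3), Lemma 2.1] [cite: DuminilCopinSmirnov2012, Lemma 1 and its proof] -/
theorem vertexFunctional_printed_pi_div_three_ne_zero_of_cone (Dl : List Face) (w : Face)
    (hw : ((w.1 - 1 : ℤ), w.2) ∉ Dl) {f : Face} (hf : f ∈ Dl) (u : ℂ)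
    (h₁ : ∀ P ∈ ((clsLoop (triSet (Dl.map (Face.shiftBy (-w))).toFinset) ((Face.shiftBy (-w) f).hv .W)).filter (fun P => loopWnd ((Face.shiftBy (-w) f).hv .W) P ≠ 0)), 0 < (star u * (edir ((Face.shiftBy (-w) f).hv .W) (finalDart P).1 * pwt P)).re)
    (h₂ : ∀ P ∈ ((clsLoop (triSet (Dl.map (Face.shiftBy (-w))).toFinset) ((Face.shiftBy (-w) f).hv .E)).filter (fun P => loopWnd ((Face.shiftBy (-w) f).hv .E) P ≠ 0)), 0 < (star u * (edir ((Face.shiftBy (-w) f).hv .E) (finalDart P).1 * pwt P)).re)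
    (hne : ((clsLoop (triSet (Dl.map (Face.shiftBy (-w))).toFinset) ((Face.shiftBy (-w) f).hv .W)).filter (fun P => loopWnd ((Face.shiftBy (-w) f).hv .W) P ≠ 0)).Nonempty ∨ ((clsLoop (triSet (Dl.map (Face.shiftBy (-w))).toFinset) ((Face.shiftBy (-w) f).hv .E)).filter (fun P => loopWnd ((Face.shiftBy (-w) f).hv .E) P ≠ 0)).Nonempty) :
    vertexFunctional (printedWeights (π / 3)) tFiveEighths (ybCoeff (π / 3)) Dl (w.side .W) f ≠ 0 := by
  intro h0
  have h := vertexFunctional_printed_pi_div_three_eq_sum_encircling Dl w hw hf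
  rw [h0, mul_zero] at h
  exact add_sum_ne_zero_of_cone _ _ _ _ u h₁ h₂ hne h.symm

/-- ★ **Cone ⇒ finitely many zero angles**: under the cone hypothesis at `θ = π/3` the defect `θ ↦ VF_{Dl}(w.side W; f; θ)` has at
most `4K + 1` zeros in `(0, π)`. [cite: GlazmanManolescu2019, §1 (θ = π/3), Lemma 2.1] [cite: DuminilCopinSmirnov2012, Lemma 1] -/
theorem vertexFunctional_printed_zero_set_of_cone (Dl : List Face) (w : Face)
    (hw : ((w.1 - 1 : ℤ), w.2) ∉ Dl) {f : Face} (hf : f ∈ Dl) (u : ℂ)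
    (h₁ : ∀ P ∈ ((clsLoop (triSet (Dl.map (Face.shiftBy (-w))).toFinset) ((Face.shiftBy (-w) f).hv .W)).filter (fun P => loopWnd ((Face.shiftBy (-w) f).hv .W) P ≠ 0)), 0 < (star u * (edir ((Face.shiftBy (-w) f).hv .W) (finalDart P).1 * pwt P)).re)
    (h₂ : ∀ P ∈ ((clsLoop (triSet (Dl.map (Face.shiftBy (-w))).toFinset) ((Face.shiftBy (-w) f).hv .E)).filter (fun P => loopWnd ((Face.shiftBy (-w) f).hv .E) P ≠ 0)), 0 < (star u * (edir ((Face.shiftBy (-w) f).hv .E) (finalDart P).1 * pwt P)).re)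
    (hne : ((clsLoop (triSet (Dl.map (Face.shiftBy (-w))).toFinset) ((Face.shiftBy (-w) f).hv .W)).filter (fun P => loopWnd ((Face.shiftBy (-w) f).hv .W) P ≠ 0)).Nonempty ∨ ((clsLoop (triSet (Dl.map (Face.shiftBy (-w))).toFinset) ((Face.shiftBy (-w) f).hv .E)).filter (fun P => loopWnd ((Face.shiftBy (-w) f).hv .E) P ≠ 0)).Nonempty) :
    {θ ∈ Set.Ioo 0 π |
        vertexFunctional (printedWeights θ) tFiveEighths (ybCoeff θ) Dl (w.side .W) f = 0}.Finite ∧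
      {θ ∈ Set.Ioo 0 π |
          vertexFunctional (printedWeights θ) tFiveEighths (ybCoeff θ) Dl (w.side .W) f = 0}.ncard ≤
        4 * maxExp Dl (w.side .W) f + 1 :=
  vertexFunctional_printed_zero_set_of_endpoint_ne_zero Dl (w.side .W) f
    (Or.inl (vertexFunctional_printed_pi_div_three_ne_zero_of_cone Dl w hw hf u h₁ h₂ hne))

/-- ★ **Cone ⇒ an odd-crossing excursion**: under the cone hypothesis at `θ = π/3` some class-`B2a` walk at `f` crosses the
half-line behind the root an odd number of times. [cite: GlazmanManolescu2019, Lemma 2.1, eq. (2.2) (CR); §1 (θ = π/3)]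
[cite: DuminilCopinSmirnov2012, Lemma 1] [cite: CourantRobbins1958, Ch. V Appendix §2 (the even–odd rule)] -/
theorem exists_odd_rayCountAt_of_cone (Dl : List Face) (w : Face)
    (hw : ((w.1 - 1 : ℤ), w.2) ∉ Dl) {f : Face} (hf : f ∈ Dl) (u : ℂ)
    (h₁ : ∀ P ∈ ((clsLoop (triSet (Dl.map (Face.shiftBy (-w))).toFinset) ((Face.shiftBy (-w) f).hv .W)).filter (fun P => loopWnd ((Face.shiftBy (-w) f).hv .W) P ≠ 0)), 0 < (star u * (edir ((Face.shiftBy (-w) f).hv .W) (finalDart P).1 * pwt P)).re)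
    (h₂ : ∀ P ∈ ((clsLoop (triSet (Dl.map (Face.shiftBy (-w))).toFinset) ((Face.shiftBy (-w) f).hv .E)).filter (fun P => loopWnd ((Face.shiftBy (-w) f).hv .E) P ≠ 0)), 0 < (star u * (edir ((Face.shiftBy (-w) f).hv .E) (finalDart P).1 * pwt P)).re)
    (hne : ((clsLoop (triSet (Dl.map (Face.shiftBy (-w))).toFinset) ((Face.shiftBy (-w) f).hv .W)).filter (fun P => loopWnd ((Face.shiftBy (-w) f).hv .W) P ≠ 0)).Nonempty ∨ ((clsLoop (triSet (Dl.map (Face.shiftBy (-w))).toFinset) ((Face.shiftBy (-w) f).hv .E)).filter (fun P => loopWnd ((Face.shiftBy (-w) f).hv .E) P ≠ 0)).Nonempty) :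
    ∃ (hr : RootedFace (PlaquetteWalk.dom Dl) (w.side .W) f) (ω : ΩG (PlaquetteWalk.dom Dl) (w.side .W) f)
      (hB : ω.IsB2a), Odd (ω.rayCountAt hr hB w .W) :=
  exists_odd_rayCountAt_of_vertexFunctional_printed_ne_zero (θ := π / 3)
    ⟨le_rfl, by linarith [Real.pi_pos]⟩ Dl rfl (faces_side_W_not_interior hw) f hf
    (vertexFunctional_printed_pi_div_three_ne_zero_of_cone Dl w hw hf u h₁ h₂ hne)

/-- ★★ **THE CONE CRITERION AT `θ = 2π/3`** (reflected triangulation): a one-sided cone of encircling contributions of the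
REFLECTED triangle domain through the two triangles of `ρ_w f − w`, non-empty, forces `VF_{2π/3}(Dl; w.side W; f) ≠ 0`.
[cite: GlazmanManolescu2019, §1 (θ ↔ π − θ), Lemma 2.1] [cite: DuminilCopinSmirnov2012, Lemma 1 and its proof] -/
theorem vertexFunctional_printed_two_pi_div_three_ne_zero_of_cone (Dl : List Face) (w : Face)
    (hw : ((w.1 - 1 : ℤ), w.2) ∉ Dl) {f : Face} (hf : f ∈ Dl) (u : ℂ)
    (h₁ : ∀ P ∈ ((clsLoop (triSet ((Dl.map (mirrorRowFace w.2)).map (Face.shiftBy (-w))).toFinset) ((Face.shiftBy (-w) (mirrorRowFace w.2 f)).hv .W)).filter (fun P => loopWnd ((Face.shiftBy (-w) (mirrorRowFace w.2 f)).hv .W) P ≠ 0)), 0 < (star u * (edir ((Face.shiftBy (-w) (mirrorRowFace w.2 f)).hv .W) (finalDart P).1 * pwt P)).re)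
    (h₂ : ∀ P ∈ ((clsLoop (triSet ((Dl.map (mirrorRowFace w.2)).map (Face.shiftBy (-w))).toFinset) ((Face.shiftBy (-w) (mirrorRowFace w.2 f)).hv .E)).filter (fun P => loopWnd ((Face.shiftBy (-w) (mirrorRowFace w.2 f)).hv .E) P ≠ 0)), 0 < (star u * (edir ((Face.shiftBy (-w) (mirrorRowFace w.2 f)).hv .E) (finalDart P).1 * pwt P)).re)
    (hne : ((clsLoop (triSet ((Dl.map (mirrorRowFace w.2)).map (Face.shiftBy (-w))).toFinset) ((Face.shiftBy (-w) (mirrorRowFace w.2 f)).hv .W)).filter (fun P => loopWnd ((Face.shiftBy (-w) (mirrorRowFace w.2 f)).hv .W) P ≠ 0)).Nonempty ∨ ((clsLoop (triSet ((Dl.map (mirrorRowFace w.2)).map (Face.shiftBy (-w))).toFinset) ((Face.shiftBy (-w) (mirrorRowFace w.2 f)).hv .E)).filter (fun P => loopWnd ((Face.shiftBy (-w) (mirrorRowFace w.2 f)).hv .E) P ≠ 0)).Nonempty) :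
    vertexFunctional (printedWeights (2 * π / 3)) tFiveEighths (ybCoeff (2 * π / 3)) Dl (w.side .W) f ≠ 0 := by
  intro h0
  have h := vertexFunctional_printed_two_pi_div_three_eq_neg_conj_sum_encircling Dl w hw hf
  rw [h0, mul_zero] at h
  have h' := congrArg (starRingEnd ℂ) h
  rw [map_zero, map_neg, Complex.conj_conj] at h'
  exact add_sum_ne_zero_of_cone _ _ _ _ u h₁ h₂ hne (by linear_combination h')

end Cone


/-! ## §10. Glazman–Manolescu's returning walks ARE Duminil-Copin–Smirnov's loop class (edition 6): a Yang–Baxter walk of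
non-zero `π/3`-weight that crosses a rhombus `f` by a NON-θ-corner arc (a `(π−θ)`-corner or a straight arc — both triangles of `f`)
and later returns to a side of `f` from outside is, under the dictionary, a LOOP-CLASS honeycomb walk at the triangle of `f` across
its final side -/

section LoopClass

open HV

/-- ★★ **RETURNING YANG–BAXTER WALKS ARE LOOP-CLASS HONEYCOMB WALKS.** Root at the origin (`(−1, 0) ∉ Dl`). Let `γ` be a
Yang–Baxter walk of `dom Dl` from the origin to the side `σ₂` of a rhombus `f`, of non-zero `π/3`-weight, whose LAST arc is
not inside `f` (it arrives at `f.side σ₂` from the neighbour) and which carries inside `f` an arc that is NOT a `θ`-corner arc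
(so that arc crossed BOTH triangles of `f`). Then its honeycomb walk belongs to Duminil-Copin–Smirnov's loop class at the
triangle `f.hv σ₂`: it is a self-avoiding mid-edge walk of the triangle domain whose final half-edge arrives at the vertex
`f.hv σ₂`, visited before. (This is the walk-level reason why the lane's «wound class-B2a walks with a (π−θ)-corner or straight
prefix arc, w₂-free» are counted by the encircling honeycomb sums of §15/#493 — the winding side, `loopWnd ≠ 0 ⟺` the
excursion winds about the hole, is not formalised here; a `θ`-corner prefix arc crosses ONE triangle only and gives no
loop-class walk at `f` in this triangulation, cf. the venture lane's «one-triangulation-only» cells and double hexagonal zeros.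
For a root on the `W` side of any rhombus `w` apply the statement to the translated list `Dl − w` and the translated walk,
dictionary §13 `YBWalk.shiftByEquiv`; for the second hexagonal angle, to the row-reflected walk of §2.)
[cite: GlazmanManolescu2019, §1 (θ = π/3: the walk becomes the hexagonal-lattice walk), Lemma 2.1]
[cite: DuminilCopinSmirnov2012, proof of Lemma 1 (the walks «visiting all three mid-edges» of a vertex: a self-avoiding path plus a loop)] -/
theorem YBWalk.hvWalk_mem_clsLoop_of_nonCorner_arc (Dl : List Face) (hD : ((-1 : ℤ), (0 : ℤ)) ∉ Dl) {f : Face}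
    {σ₂ : Side} (γ : YBWalk (PlaquetteWalk.dom Dl) origin (f.side σ₂))
    (hw : γ.weight (fun _ => π / 3) ≠ 0) (hn : 0 < γ.arcs.length) (hlast : γ.fc (γ.arcs.length - 1) ≠ f)
    (harc : ∃ κ, κ ≠ ArcKind.corner ∧ κ ∈ γ.kindsIn f) :
    γ.hvWalk ∈ clsLoop (triSet Dl.toFinset) (f.hv σ₂) := by
  have hD' : ((-1 : ℤ), (0 : ℤ)) ∉ PlaquetteWalk.dom Dl := hD
  have hV : ∀ g ∈ PlaquetteWalk.dom Dl, ∀ s : Side, g.hv s ∈ triSet Dl.toFinset :=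
    fun g hg s => hv_mem_triSet (List.mem_toFinset.2 hg) s
  unfold clsLoop
  rw [Finset.mem_filter]
  refine ⟨mem_midWalks_iff.2 (γ.isMidWalk_hvWalk_of_origin hD' hV hw), ?_, ?_⟩
  · rw [γ.finalDart_hvWalk_of_origin hD' hn]
    exact YBWalk.acrossOut_last_eq_hv rfl hn hlast
  · rw [γ.inner_hvWalk_of_origin hD']
    exact γ.hv_mem_hvInner_of_kindsIn (Or.inl harc) σ₂

end LoopClass

end Literature.Probability.RandomPlanarGeometry.SAW.YangBaxter
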